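import Mathlib.Analysis.Normed.Group.Seminorm
import Mathlib.Analysis.SpecialFunctions.Pow.Real
import Mathlib.Analysis.Calculus.MeanValue
import Mathlib.Algebra.Ring.GeomSum
import HarnessLib

/-!
# Saint-Raymond's simple Nash–Moser implicit function theorem (L'Enseignement Math. 35 (1989))

Analysis/Calculus file: a KERNEL PROOF of the main (and only) theorem of
X. Saint Raymond, *A simple Nash–Moser implicit function theorem*, Enseign. Math. (2) **35**
(1989) 217–226 [SaintRaymond1989], in the abstract form of its Remark (p.220: graded scales with
smoothing operators in place of `H^s(ℝⁿ)`, `H^s(Ω)`), following the printed proof step by step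
(Lemma 1 with its three inductive estimates (i)ₖ (ii)ₖ (iii)ₖ and the displays (5)–(11); Lemma 2 and
(12); the half-page "Proof of the theorem", p.223).  The same statement is restated verbatim as
Theorem 11.1 of P. Hintz, A. Vasy, *The global non-linear stability of the Kerr–de Sitter family of
black holes*, Acta Math. **220** (2018) [HintzVasy2018, §11.1], and it is "the main result of
[SR89]" invoked in P. Hintz, arXiv:2606.28253v2 (2026), proof of Thm 13.1, Step 3 (TeX l.15171–15183)
and proof of Thm 5.17 (l.5278); the typed interface to that use is the companion
`Literature/Geometry/Lorentzian/Hintz2026/NashMoserInterface.lean`.  Reusable far beyond that cell: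
this is the plain Moser–Nash scheme `u_{k+1} = u_k + S_{θ_k} ψ(u_k)(−φ(u_k))`, `θ_{k+1} = θ_k^{5/4}`.

## Contents

* §0 the printed integers `N = 4(2d+1)`, `T = 3d+3+(2d+3)(N+3)`, `D = T+2d`, and `D_eq`:
  `D = 16d²+43d+24` (the "— sic" constant of the Theorem, REPRODUCED);
* §1 the sequence `θ_k` and the facts (5) (`rpow_le_theta : θ₀^{1+j/4} ≤ θ_j`,
  `sum_theta_rpow_neg_three_le`, `exists_le_theta`);
* §2 `Hypotheses` = (1)–(4) + monotone gradations; `IsComplete`; the EXPLICIT constants of the proof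
  `V₀ W U V₁ V C₀ theta0` and the smallness `threshold := theta0^{-4}` — functions of
  `d, δ, M (≥ |u₀|_D), C₁, C₂, (C_s), (C_{s,t})` only, which is the printed "sufficiently small
  with respect to some upper bound of `1/δ`, `|u₀|_D` and `(C_s)_{s≤D}`"; the scheme `seq`/`incr`;
* §3 Lemma 1: `lem7` (7), `lem9` (9), `lemiii` (iii)ₖ, `lem10` (10), `lemii` (ii)ₖ, `good_succ`
  ((i)ₖ₊₁ from (11) and the Taylor formula), `good` (all (i)ₖ), `incr_le` (all (ii)ₖ);
* §4 Lemma 2 `lemma2` (eventual monotonicity of `(1+|u_k|_{t+2d})θ_k^{-N}`, (12), interpolation),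
  `tail_le`, `cauchy`;
* §5 **`exists_zero`** — the theorem;
* §6 from the printed `C²` lines of (1) to the integrated bounds used (`norm_sub_le_of_norm_fderiv_le`,
  `norm_taylor₂_le_of_norm_fderiv₂_le`, Mathlib's mean value inequality).

## Design choices (deviations from the letter of the print, none from its content)

1. SETTING.  `E` (= `B_∞`) and `F` (= `𝐁_∞`) are bare additive commutative groups graded by families
   of `AddGroupSeminorm`s `p s`, `q s` (`s : ℕ`); the smoothing operators `S θ : E → E` are arbitrary
   maps (only the two inequalities (4) are used — linearity is never used in the printed proof);
   `φ' u : E →+ F` is additive (used once: `φ'(u_k)(S v_k) = φ'(u_k)(S v_k − v_k) + φ'(u_k)v_k`);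
   `ψ u : F → E` arbitrary.  This is MORE general than gradations of Banach spaces.
2. THE `C²` HYPOTHESIS.  The second and third lines of (1) enter the printed proof only through the
   two integrals on p.222 (Taylor) and p.223 (mean value); we assume exactly those two integrated
   inequalities (`Hypotheses.lipschitz`, `Hypotheses.taylor`, constant `C₂` for the printed `C₂/2`)
   and keep the line `‖φ'(u)v‖_{2d} ≤ C₁|v|_{3d}` itself (`deriv_le`, used on p.222 for `φ₁`).  §6
   derives the integrated forms from the differential ones for maps of real normed spaces.
3. `θ₀ ≥ 16` instead of the printed `θ₀ ≥ 2` as the floor under the (anyway large) `θ₀` — it makes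
   `θ₀^{-3/4} ≤ 1/8` available (`16^{3/4} = 8` by `norm_num`); (5) is proved as
   `Σ_{j<n} θ_j^{-3} ≤ 2θ₀^{-3} ≤ θ₀^{-1}/128`, and `θ_k → ∞` as `θ₀^{j+1} ≤ θ_{4j}`.
4. (9) is closed with the printed `‖φ(u_k)‖_{2d} ≤ θ_k^{-4} ≤ 1` ((i)ₖ) instead of the equally printed
   `≤ C_{2d}(1+δ+|u₀|_{3d})`; the constant `W_t = C_t(C_{t+d}+1)` is simpler, nothing else changes.
5. COMPLETENESS is the sequential completeness of `E` for the whole family (`IsComplete`), stated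
   with `ε`/`K` (no filters), and "norm" on the target is used only as: `q (2d) w = 0 → w = 0`.
6. The conclusion records `|u − u₀|_{3d} < δ` (the print's (11) gives `≤ C_{3d,3d}VΣθ_j^{-3} < δ`;
   here `≤ δ/128`), which the printed statement leaves implicit.

NOT here: the construction of smoothing operators on `H^s(ℝⁿ)` (the paper's Appendix), the
isometric-embedding illustration (pp.224–225), optimal loss counts (Hörmander's versions), and any
instantiation to a concrete PDE.  No named facts; theorems and definitions only (D-0014/D-0026).

## References

* X. Saint Raymond, *A simple Nash–Moser implicit function theorem*, Enseign. Math. (2) 35 (1989),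
  no. 3-4, 217–226, doi:10.5169/seals-57374 (e-periodica; corpus `paper:doi-10-5169-seals-57374`,
  pp.217–224 = files p0002–p0009). [SaintRaymond1989]
* P. Hintz, A. Vasy, *The global non-linear stability of the Kerr–de Sitter family of black holes*,
  Acta Math. 220 (2018) 1–206, Thm 11.1 (restatement). [HintzVasy2018]
* P. Hintz, *Nonlinear stability of subextremal Kerr black holes*, arXiv:2606.28253v2 (2026), §13
  Step 3 and §5.4 (uses). [Hintz2026]
-/

noncomputable section

open Finset

namespace Literature.Analysis.Calculus

namespace SaintRaymond

/-! ## §0 The printed integer parameters `N`, `T`, `D` -/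

/-- `N = 4(2d+1)`, the growth exponent of the high norms along the iteration.
[cite: SaintRaymond1989, proof of Lemma 1, p.221 ("We now fix the values N = 4(2d+1) and
T = 3d+3+(2d+3)(N+3)")] -/
def N (d : ℕ) : ℕ := 4 * (2 * d + 1)

/-- `T = 3d+3+(2d+3)(N+3)`, the high norm index used in the interpolation step.
[cite: SaintRaymond1989, proof of Lemma 1, p.221] -/
def T (d : ℕ) : ℕ := 3 * d + 3 + (2 * d + 3) * (N d + 3)

/-- `D = T + 2d`, the number of "derivatives" of `u₀` entering the smallness threshold.
[cite: SaintRaymond1989, Theorem, p.220] -/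
def D (d : ℕ) : ℕ := T d + 2 * d

/-- The printed value `D = 16d² + 43d + 24` ("— sic", p.220) is exactly `T + 2d`.
[cite: SaintRaymond1989, Theorem, p.220] -/
theorem D_eq (d : ℕ) : D d = 16 * d ^ 2 + 43 * d + 24 := by
  unfold D T N; ring

/-- `N = 8d + 4`. [cite: SaintRaymond1989, p.221] -/
theorem N_eq (d : ℕ) : N d = 8 * d + 4 := by unfold N; ring

/-- `T = 16d² + 41d + 24`. [cite: SaintRaymond1989, p.221] -/
theorem T_eq (d : ℕ) : T d = 16 * d ^ 2 + 41 * d + 24 := by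
  unfold T N; ring

/-- `3d + 3 ≤ T` (the interpolation in the proof of (ii) is between the indices `d < 3d+3 ≤ T`).
[cite: SaintRaymond1989, p.221] -/
theorem three_d_three_le_T (d : ℕ) : 3 * d + 3 ≤ T d := by
  unfold T; exact Nat.le_add_right _ _

/-- The real identity behind the choice `N = 4(2d+1)`: `(5/4)·N = N + 2d + 1`, i.e.
`θ_{k+1}^N = θ_k^{N+2d+1}`. [cite: SaintRaymond1989, p.221 (proof of (10))] -/
theorem five_quarters_N (d : ℕ) : (5 : ℝ) / 4 * (N d : ℝ) = (N d : ℝ) + 2 * d + 1 := by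
  rw [N_eq]; push_cast; ring

/-! ## §1 The sequence `θ_k` (`θ₀` given, `θ_{k+1} = θ_k^{5/4}`) and the facts (5) -/

/-- The smoothing parameters `θ₀, θ₁ = θ₀^{5/4}, …, θ_{k+1} = θ_k^{5/4}`.
[cite: SaintRaymond1989, Remark, p.220] -/
def theta (θ₀ : ℝ) : ℕ → ℝ
  | 0 => θ₀
  | k + 1 => theta θ₀ k ^ ((5 : ℝ) / 4)

variable {θ₀ : ℝ}

/-- [cite: SaintRaymond1989, Remark, p.220] -/
@[simp] theorem theta_zero : theta θ₀ 0 = θ₀ := rfl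

/-- [cite: SaintRaymond1989, Remark, p.220] -/
theorem theta_succ (k : ℕ) : theta θ₀ (k + 1) = theta θ₀ k ^ ((5 : ℝ) / 4) := rfl

/-- `θ₀ ≤ θ_k` when `θ₀ ≥ 1`. [cite: SaintRaymond1989, (5), p.220] -/
theorem le_theta (h : 1 ≤ θ₀) (k : ℕ) : θ₀ ≤ theta θ₀ k := by
  induction k with
  | zero => simp
  | succ k ih =>
    rw [theta_succ]
    exact ih.trans (Real.self_le_rpow_of_one_le (h.trans ih) (by norm_num))

/-- [cite: SaintRaymond1989, (5), p.220] -/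
theorem one_le_theta (h : 1 ≤ θ₀) (k : ℕ) : 1 ≤ theta θ₀ k := h.trans (le_theta h k)

/-- [cite: SaintRaymond1989, (5), p.220] -/
theorem theta_pos (h : 1 ≤ θ₀) (k : ℕ) : 0 < theta θ₀ k := one_pos.trans_le (one_le_theta h k)

/-- [cite: SaintRaymond1989, (5), p.220] -/
theorem theta_le_succ (h : 1 ≤ θ₀) (k : ℕ) : theta θ₀ k ≤ theta θ₀ (k + 1) := by
  rw [theta_succ]; exact Real.self_le_rpow_of_one_le (one_le_theta h k) (by norm_num)

/-- [cite: SaintRaymond1989, (5), p.220] -/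
theorem theta_mono (h : 1 ≤ θ₀) : Monotone (theta θ₀) := monotone_nat_of_le_succ (theta_le_succ h)

/-- The shifted sequence is the sequence started at `θ_m`. [cite: SaintRaymond1989, (5), p.220] -/
theorem theta_add (m i : ℕ) : theta θ₀ (m + i) = theta (theta θ₀ m) i := by
  induction i with
  | zero => simp
  | succ i ih => rw [← Nat.add_assoc, theta_succ, ih, theta_succ]

/-- `θ_{k+1}^x = θ_k^{(5/4)x}`. [cite: SaintRaymond1989, (5), p.220] -/
theorem theta_succ_rpow (h : 1 ≤ θ₀) (k : ℕ) (x : ℝ) :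
    theta θ₀ (k + 1) ^ x = theta θ₀ k ^ ((5 : ℝ) / 4 * x) := by
  rw [theta_succ, ← Real.rpow_mul (theta_pos h k).le]

/-- (5): `(5/4)^j ≥ 1 + j/4` gives `θ_j ≥ θ₀^{1+j/4}`. [cite: SaintRaymond1989, (5), p.220] -/
theorem rpow_le_theta (h : 1 ≤ θ₀) (i : ℕ) : θ₀ ^ (1 + (i : ℝ) / 4) ≤ theta θ₀ i := by
  induction i with
  | zero => simp
  | succ i ih =>
    rw [theta_succ]
    have h0 : (0 : ℝ) ≤ θ₀ := zero_le_one.trans h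
    calc θ₀ ^ (1 + ((i + 1 : ℕ) : ℝ) / 4)
        ≤ θ₀ ^ ((1 + (i : ℝ) / 4) * ((5 : ℝ) / 4)) := by
          apply Real.rpow_le_rpow_of_exponent_le h
          push_cast
          nlinarith [(Nat.cast_nonneg i : (0 : ℝ) ≤ i)]
      _ = (θ₀ ^ (1 + (i : ℝ) / 4)) ^ ((5 : ℝ) / 4) := Real.rpow_mul h0 _ _
      _ ≤ theta θ₀ i ^ ((5 : ℝ) / 4) :=
          Real.rpow_le_rpow (Real.rpow_nonneg h0 _) ih (by norm_num)

/-- (5): `θ_j^{-3} ≤ θ₀^{-3} (θ₀^{-3/4})^j`. [cite: SaintRaymond1989, (5), p.220] -/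
theorem theta_rpow_neg_three_le (h : 1 ≤ θ₀) (i : ℕ) :
    theta θ₀ i ^ (-(3 : ℝ)) ≤ θ₀ ^ (-(3 : ℝ)) * (θ₀ ^ (-(3 : ℝ) / 4)) ^ i := by
  have h0 : (0 : ℝ) < θ₀ := one_pos.trans_le h
  calc theta θ₀ i ^ (-(3 : ℝ))
      ≤ (θ₀ ^ (1 + (i : ℝ) / 4)) ^ (-(3 : ℝ)) :=
        Real.rpow_le_rpow_of_nonpos (Real.rpow_pos_of_pos h0 _) (rpow_le_theta h i) (by norm_num)
    _ = θ₀ ^ (-(3 : ℝ) + (-(3 : ℝ) / 4) * (i : ℝ)) := by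
        rw [← Real.rpow_mul h0.le]; congr 1; ring
    _ = θ₀ ^ (-(3 : ℝ)) * (θ₀ ^ (-(3 : ℝ) / 4)) ^ i := by
        rw [Real.rpow_add h0, Real.rpow_mul h0.le, Real.rpow_natCast]

/-- `16^{3/4} = 8`. [folklore] -/
theorem sixteen_rpow_three_quarters : (16 : ℝ) ^ ((3 : ℝ) / 4) = 8 := by
  rw [show (16 : ℝ) = (2 : ℝ) ^ (4 : ℝ) by norm_num, ← Real.rpow_mul (by norm_num)]
  norm_num

/-- For `θ₀ ≥ 16` the ratio `θ₀^{-3/4}` is at most `1/8`. [cite: SaintRaymond1989, (5), p.220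
(printed with `θ₀ ≥ 2`; any fixed lower bound `> 1` works, we take `16` for round numbers)] -/
theorem ratio_le (h : 16 ≤ θ₀) : θ₀ ^ (-(3 : ℝ) / 4) ≤ 1 / 8 := by
  have h0 : (0 : ℝ) < θ₀ := by linarith
  have h8 : (8 : ℝ) ≤ θ₀ ^ ((3 : ℝ) / 4) := by
    rw [← sixteen_rpow_three_quarters]
    exact Real.rpow_le_rpow (by norm_num) h (by norm_num)
  rw [show -(3 : ℝ) / 4 = -((3 : ℝ) / 4) by ring, Real.rpow_neg h0.le]
  rw [one_div]
  exact inv_anti₀ (by norm_num) h8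

/-- (5): `Σ_{j<n} θ_j^{-3} ≤ (8/7) θ₀^{-3} ≤ 2 θ₀^{-3}` (printed: `≤ θ₀^{-3}(1-θ₀^{-3/4})^{-1} < θ₀^{-1}`).
[cite: SaintRaymond1989, (5), p.220] -/
theorem sum_theta_rpow_neg_three_le (h : 16 ≤ θ₀) (n : ℕ) :
    ∑ i ∈ range n, theta θ₀ i ^ (-(3 : ℝ)) ≤ 2 * θ₀ ^ (-(3 : ℝ)) := by
  have h1 : (1 : ℝ) ≤ θ₀ := by linarith
  have h0 : (0 : ℝ) < θ₀ := by linarith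
  set r : ℝ := θ₀ ^ (-(3 : ℝ) / 4) with hr
  have hr0 : 0 ≤ r := Real.rpow_nonneg h0.le _
  have hr1 : r ≤ 1 / 8 := ratio_le h
  have hgeom : ∑ i ∈ range n, r ^ i ≤ 2 := by
    have hmul := geom_sum_mul_neg r n
    have hrn : 0 ≤ r ^ n := pow_nonneg hr0 n
    have h78 : (7 : ℝ) / 8 ≤ 1 - r := by linarith
    have hS : 0 ≤ ∑ i ∈ range n, r ^ i := sum_nonneg fun i _ => pow_nonneg hr0 i
    nlinarith
  calc ∑ i ∈ range n, theta θ₀ i ^ (-(3 : ℝ))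
      ≤ ∑ i ∈ range n, θ₀ ^ (-(3 : ℝ)) * r ^ i :=
        sum_le_sum fun i _ => theta_rpow_neg_three_le h1 i
    _ = θ₀ ^ (-(3 : ℝ)) * ∑ i ∈ range n, r ^ i := by rw [mul_sum]
    _ ≤ θ₀ ^ (-(3 : ℝ)) * 2 :=
        mul_le_mul_of_nonneg_left hgeom (Real.rpow_nonneg h0.le _)
    _ = 2 * θ₀ ^ (-(3 : ℝ)) := by ring

/-- `2 θ₀^{-3} < θ₀^{-1}` for `θ₀ ≥ 16` (printed: `Σ θ_j^{-3} < θ₀^{-1}`).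
[cite: SaintRaymond1989, (5), p.220] -/
theorem two_rpow_neg_three_le (h : 16 ≤ θ₀) : 2 * θ₀ ^ (-(3 : ℝ)) ≤ θ₀ ^ (-(1 : ℝ)) / 128 := by
  have h0 : (0 : ℝ) < θ₀ := by linarith
  rw [Real.rpow_neg h0.le, Real.rpow_neg h0.le, Real.rpow_one,
    show (3 : ℝ) = ((3 : ℕ) : ℝ) by norm_num, Real.rpow_natCast]
  rw [show (θ₀ ^ 3)⁻¹ = θ₀⁻¹ * (θ₀ ^ 2)⁻¹ by
    rw [← mul_inv, show θ₀ * θ₀ ^ 2 = θ₀ ^ 3 by ring]]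
  have h2 : (256 : ℝ) ≤ θ₀ ^ 2 := by nlinarith
  have hi : (θ₀ ^ 2)⁻¹ ≤ 1 / 256 := by
    rw [one_div]; exact inv_anti₀ (by norm_num) h2
  have hθi : 0 ≤ θ₀⁻¹ := (inv_pos.mpr h0).le
  calc 2 * (θ₀⁻¹ * (θ₀ ^ 2)⁻¹) ≤ 2 * (θ₀⁻¹ * (1 / 256)) := by gcongr
    _ = θ₀⁻¹ / 128 := by ring

/-- The tail version of (5): the sum started at `m`. [cite: SaintRaymond1989, (5), p.220] -/
theorem sum_theta_rpow_neg_three_tail_le (h : 16 ≤ θ₀) (m n : ℕ) :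
    ∑ i ∈ range n, theta θ₀ (m + i) ^ (-(3 : ℝ)) ≤ 2 * theta θ₀ m ^ (-(3 : ℝ)) := by
  have hm : 16 ≤ theta θ₀ m := h.trans (le_theta (by linarith) m)
  simp_rw [theta_add m]
  exact sum_theta_rpow_neg_three_le hm n

/-- `θ₀^{j+1} ≤ θ_{4j}` (from (5) at `4j`), hence `θ_k → ∞`. [cite: SaintRaymond1989, proof of
Lemma 2, p.223 ("θ_k tends to infinity")] -/
theorem pow_le_theta (h : 1 ≤ θ₀) (j : ℕ) : θ₀ ^ (j + 1) ≤ theta θ₀ (4 * j) := by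
  have h1 := rpow_le_theta h (4 * j)
  rw [show (1 : ℝ) + ((4 * j : ℕ) : ℝ) / 4 = ((j + 1 : ℕ) : ℝ) by push_cast; ring,
    Real.rpow_natCast] at h1
  exact h1

/-- For every bound `R` the `θ_k` eventually exceed it. [cite: SaintRaymond1989, proof of Lemma 2,
p.223] -/
theorem exists_le_theta (h : 16 ≤ θ₀) (R : ℝ) : ∃ K : ℕ, ∀ k, K ≤ k → R ≤ theta θ₀ k := by
  have h1 : (1 : ℝ) ≤ θ₀ := by linarith
  obtain ⟨j, hj⟩ := pow_unbounded_of_one_lt R (by norm_num : (1 : ℝ) < 16)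
  refine ⟨4 * j, fun k hk => hj.le.trans ?_⟩
  calc (16 : ℝ) ^ j ≤ 16 ^ (j + 1) := pow_le_pow_right₀ (by norm_num) (Nat.le_succ j)
    _ ≤ θ₀ ^ (j + 1) := pow_le_pow_left₀ (by norm_num) h (j + 1)
    _ ≤ theta θ₀ (4 * j) := pow_le_theta h1 j
    _ ≤ theta θ₀ k := theta_mono h1 hk

/-! ## §2 The abstract setting of the Remark (p.220) and the hypotheses (1)–(4) -/

variable {E : Type*} {F : Type*} [AddCommGroup E]

section Hyp

variable [AddCommGroup F]

/-- **The hypotheses of Saint-Raymond's theorem**, in the abstract form of his Remark (p.220: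
"one can replace these spaces by gradations of Banach spaces `B_s` and `𝐁_s` respectively with
norms `| |_s` and `‖ ‖_s` if there exist some smoothing operators `(S_θ)_{θ>1} : B_∞ → B_∞`
satisfying (4) …; we will also assume that `|v|_s ≤ |v|_t` whenever `s ≤ t`").

Data: the graded group `E` (= `B_∞`) with seminorms `p s` (= `| |_s`), the graded group `F`
(= `𝐁_∞`) with seminorms `q s` (= `‖ ‖_s`), smoothing operators `S θ`, the map `φ`, its
derivative `φ' u` (an additive map), the right inverses `ψ u`, the base point `u₀`, and the printed
constants `d`, `δ`, `C₁`, `C₂`, `(C_s)`, together with the constants `C_{s,t}` of (4) (`Csm`).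

Fields = the printed hypotheses: `p_mono`/`q_mono` (monotone gradations), `smooth_le` /
`sub_smooth_le` = (4), `tame` = (1) first line, `deriv_le` = (1) second line, `right_inv` = (2),
`tame_inv` = (3).  The printed second and third lines of (1) ("`‖φ'(u)v‖_{2d} ≤ C₁|v|_{3d}`,
`‖φ''(u)(v,w)‖_{2d} ≤ C₂|v|_{3d}|w|_{3d}`", for a `C²` map `φ`) enter the printed proof ONLY through
their integrated forms on the (convex) ball `|u − u₀|_{3d} < δ`: the mean-value bound `lipschitz`
(used on p.223, last display: "`‖∫₀¹ φ'(u_k + t(u − u_k))(u − u_k) dt‖_{2d} ≤ C₁|u − u_k|_{3d}`")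
and the second-order Taylor bound `taylor` (used on p.222: "we write the following Taylor formula
… `φ₂ = ∫₀¹ (1−t) φ''(u_k + tS_{θ_k}v_k)(S_{θ_k}v_k, S_{θ_k}v_k) dt`", with `C₂` for the printed
`C₂/2`).  We take these two integrated bounds as the hypotheses, which is what makes the statement
meaningful for bare graded groups (no scalar multiplication, no integration is needed); for a `C²`
map between Banach spaces they follow from the printed lines by the mean value theorem.
Nonnegativity of the constants is recorded explicitly.
[cite: SaintRaymond1989, Theorem and Remark, pp.219–220] -/
structure Hypotheses (p : ℕ → AddGroupSeminorm E) (q : ℕ → AddGroupSeminorm F)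
    (S : ℝ → E → E) (φ : E → F) (φ' : E → E →+ F) (ψ : E → F → E) (u₀ : E)
    (d : ℕ) (δ C₁ C₂ : ℝ) (C : ℕ → ℝ) (Csm : ℕ → ℕ → ℝ) : Prop where
  /-- "an integer `d > 0`" -/
  d_pos : 0 < d
  /-- "a real number `δ`" (positive: it is the radius of the ball in (1)) -/
  δ_pos : 0 < δ
  C₁_nonneg : 0 ≤ C₁
  C₂_nonneg : 0 ≤ C₂
  C_nonneg : ∀ s, 0 ≤ C s
  Csm_nonneg : ∀ s t, 0 ≤ Csm s t
  /-- "`|v|_s ≤ |v|_t` whenever `s ≤ t`" (Remark p.220) -/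
  p_mono : ∀ s t : ℕ, s ≤ t → ∀ v : E, p s v ≤ p t v
  /-- the same for the target gradation -/
  q_mono : ∀ s t : ℕ, s ≤ t → ∀ w : F, q s w ≤ q t w
  /-- (4), first line: `|S_θ v|_s ≤ C_{s,t} θ^{s-t} |v|_t` if `s ≥ t` -/
  smooth_le : ∀ θ : ℝ, 1 < θ → ∀ s t : ℕ, t ≤ s → ∀ v : E,
    p s (S θ v) ≤ Csm s t * θ ^ ((s : ℝ) - t) * p t v
  /-- (4), second line: `|v - S_θ v|_s ≤ C_{s,t} θ^{s-t} |v|_t` if `s ≤ t` -/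
  sub_smooth_le : ∀ θ : ℝ, 1 < θ → ∀ s t : ℕ, s ≤ t → ∀ v : E,
    p s (v - S θ v) ≤ Csm s t * θ ^ ((s : ℝ) - t) * p t v
  /-- (1), first line: `|u-u₀|_{3d} < δ ⇒ ∀ s ≥ d, ‖φ(u)‖_s ≤ C_s (1 + |u|_{s+d})` -/
  tame : ∀ u : E, p (3 * d) (u - u₀) < δ → ∀ s : ℕ, d ≤ s → q s (φ u) ≤ C s * (1 + p (s + d) u)
  /-- (1), second line: `|u-u₀|_{3d} < δ ⇒ ‖φ'(u)v‖_{2d} ≤ C₁ |v|_{3d}` -/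
  deriv_le : ∀ u : E, p (3 * d) (u - u₀) < δ → ∀ v : E, q (2 * d) (φ' u v) ≤ C₁ * p (3 * d) v
  /-- (1), second line, integrated along segments of the ball (mean value inequality) -/
  lipschitz : ∀ u u' : E, p (3 * d) (u - u₀) < δ → p (3 * d) (u' - u₀) < δ →
    q (2 * d) (φ u' - φ u) ≤ C₁ * p (3 * d) (u' - u)
  /-- (1), third line, integrated along segments of the ball (Taylor's formula of order two) -/
  taylor : ∀ u u' : E, p (3 * d) (u - u₀) < δ → p (3 * d) (u' - u₀) < δ →
    q (2 * d) (φ u' - φ u - φ' u (u' - u)) ≤ C₂ * p (3 * d) (u' - u) ^ 2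
  /-- (2): `φ'(u) ψ(u) g = g` on the ball -/
  right_inv : ∀ u : E, p (3 * d) (u - u₀) < δ → ∀ g : F, φ' u (ψ u g) = g
  /-- (3): the tame estimate `|ψ(u) g|_s ≤ C_s (‖g‖_{s+d} + |u|_{s+d} ‖g‖_{2d})`, `s ≥ d` -/
  tame_inv : ∀ u : E, p (3 * d) (u - u₀) < δ → ∀ s : ℕ, d ≤ s → ∀ g : F,
    p s (ψ u g) ≤ C s * (q (s + d) g + p (s + d) u * q (2 * d) g)

end Hyp

/-- Sequential completeness of the graded group `E = B_∞ = ⋂ B_s` ("gradations of Banach spaces",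
Remark p.220): a sequence which is Cauchy for every seminorm `p s` converges, for every `p s`, to one
and the same limit. [cite: SaintRaymond1989, Remark, p.220] -/
def IsComplete (p : ℕ → AddGroupSeminorm E) : Prop :=
  ∀ x : ℕ → E, (∀ s : ℕ, ∀ ε : ℝ, 0 < ε → ∃ K : ℕ, ∀ m n : ℕ, K ≤ m → K ≤ n → p s (x m - x n) < ε) →
    ∃ y : E, ∀ s : ℕ, ∀ ε : ℝ, 0 < ε → ∃ K : ℕ, ∀ n : ℕ, K ≤ n → p s (x n - y) < ε

/-! ### The constants of the proof (all functions of `d, δ, M ≥ |u₀|_D, C₁, C₂, (C_s), (C_{s,t})` only) -/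

section Constants

variable (d : ℕ) (δ M C₁ C₂ : ℝ) (C : ℕ → ℝ) (Csm : ℕ → ℕ → ℝ)

/-- `V₀ = C_d (1 + δ + |u₀|_{2d})` of (7), with `|u₀|_{2d} ≤ M`. [cite: SaintRaymond1989, (7), p.221] -/
def V₀ : ℝ := C d * (1 + δ + M)

/-- The constant of (9): `|v_k|_t ≤ W_t (1 + |u_k|_{t+2d})`.  (The print bounds `‖φ(u_k)‖_{2d}` by
`C_{2d}(1 + δ + |u₀|_{3d})`; we use the equally printed `‖φ(u_k)‖_{2d} ≤ θ_k^{-4} ≤ 1` from (i)_k.)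
[cite: SaintRaymond1989, (9), p.221] -/
def W (t : ℕ) : ℝ := C t * (C (t + d) + 1)

/-- The constant `U_t` of (iii): `1 + |u_{k+1}|_{t+2d} ≤ U_t θ_k^{2d} (1 + |u_k|_{t+2d})`.
[cite: SaintRaymond1989, Lemma 1 (iii), p.220 and its proof p.222] -/
def U (t : ℕ) : ℝ := 1 + Csm (t + 2 * d) t * W d C t

/-- `V₁` of (8): `|v_k|_T ≤ V₁ θ_k^N`, "`V₁` depends only on `|u₀|_{T+2d}` and the constants `C`".
[cite: SaintRaymond1989, (8)–(10), p.221] -/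
def V₁ : ℝ := W d C (T d) * (1 + M)

/-- `V` of (ii): `|v_k|_{3d+3} ≤ V θ_k^{-3}`. [cite: SaintRaymond1989, Lemma 1 (ii), pp.220–221] -/
def V : ℝ := Csm (3 * d + 3) d * V₀ d δ M C + Csm (3 * d + 3) (T d) * V₁ d M C

/-- `C₀` of the last display of p.222: `‖φ(u_{k+1})‖_{2d} ≤ C₀ θ_k^{-6}`.
[cite: SaintRaymond1989, proof of (i), p.222] -/
def C₀ : ℝ :=
  C₁ * Csm (3 * d) (3 * d + 3) * V d δ M C Csm + C₂ * (Csm (3 * d) (3 * d) * V d δ M C Csm) ^ 2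

/-- The choice of `θ₀` ("`θ₀ ≥ 2` to be chosen", then `θ₀ ≥ U_T` (p.221), `θ₀ ≥ C₀` (p.222) and
`θ₀` large enough for (11) (p.222)); we use `16` as the absolute lower bound.
[cite: SaintRaymond1989, pp.220–222] -/
def theta0 : ℝ :=
  max (max 16 (U d C Csm (T d))) (max (C₀ d δ M C₁ C₂ C Csm) (Csm (3 * d) (3 * d) * V d δ M C Csm / δ))

/-- **The smallness threshold** `θ₀^{-4}` for `‖φ(u₀)‖_{2d}` (Lemma 1: "if `‖φ(u₀)‖_{2d} ≤ θ₀^{-4}`"),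
an explicit function of `d`, `δ`, `M ≥ |u₀|_D`, `C₁`, `C₂`, `(C_s)`, `(C_{s,t})` only — this is the
printed "sufficiently small (with respect to some upper bound of `1/δ`, `|u₀|_D` and `(C_s)_{s≤D}`)".
[cite: SaintRaymond1989, Theorem p.220 and Lemma 1 p.220] -/
def threshold : ℝ := theta0 d δ M C₁ C₂ C Csm ^ (-(4 : ℝ))

/-- `16 ≤ θ₀`. [cite: SaintRaymond1989, p.220 ("θ₀ ≥ 2 to be chosen")] -/
theorem sixteen_le_theta0 : 16 ≤ theta0 d δ M C₁ C₂ C Csm :=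
  le_max_of_le_left (le_max_left _ _)

/-- `U_T ≤ θ₀` (p.221: "if one takes θ₀ ≥ U_T"). [cite: SaintRaymond1989, p.221] -/
theorem U_le_theta0 : U d C Csm (T d) ≤ theta0 d δ M C₁ C₂ C Csm :=
  le_max_of_le_left (le_max_right _ _)

/-- `C₀ ≤ θ₀` (p.222: "for θ₀ ≥ C₀, we thus get (i)_{k+1}"). [cite: SaintRaymond1989, p.222] -/
theorem C₀_le_theta0 : C₀ d δ M C₁ C₂ C Csm ≤ theta0 d δ M C₁ C₂ C Csm :=
  le_max_of_le_right (le_max_left _ _)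

/-- `C_{3d,3d} V / δ ≤ θ₀` (p.222, (11): "so that we have for θ₀ … < δ"). [cite: SaintRaymond1989, (11), p.222] -/
theorem quot_le_theta0 : Csm (3 * d) (3 * d) * V d δ M C Csm / δ ≤ theta0 d δ M C₁ C₂ C Csm :=
  le_max_of_le_right (le_max_right _ _)

/-- `0 < θ₀`. [cite: SaintRaymond1989, p.220] -/
theorem theta0_pos : 0 < theta0 d δ M C₁ C₂ C Csm :=
  lt_of_lt_of_le (by norm_num) (sixteen_le_theta0 d δ M C₁ C₂ C Csm)

/-- The threshold is positive (no hypothesis needed). [cite: SaintRaymond1989, Theorem p.220] -/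
theorem threshold_pos : 0 < threshold d δ M C₁ C₂ C Csm :=
  Real.rpow_pos_of_pos (theta0_pos d δ M C₁ C₂ C Csm) _

end Constants

/-! ### The Moser–Nash scheme `u_{k+1} = u_k + S_{θ_k} v_k`, `v_k = -ψ(u_k) φ(u_k)` -/

section Scheme

variable (S : ℝ → E → E) (φ : E → F) (ψ : E → F → E) (u₀ : E) (θ₀ : ℝ)

/-- The iterates `u_k`: `u_0 = u₀`, `u_{k+1} = u_k + S_{θ_k} v_k` with `v_k = -ψ(u_k)φ(u_k)`.
[cite: SaintRaymond1989, Lemma 1, p.220] -/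
def seq : ℕ → E
  | 0 => u₀
  | k + 1 => seq k + S (theta θ₀ k) (-(ψ (seq k) (φ (seq k))))

/-- The increments `v_k = -ψ(u_k) φ(u_k)`. [cite: SaintRaymond1989, Lemma 1, p.220] -/
def incr (k : ℕ) : E := -(ψ (seq S φ ψ u₀ θ₀ k) (φ (seq S φ ψ u₀ θ₀ k)))

/-- `u_0 = u₀`. [cite: SaintRaymond1989, Lemma 1, p.220] -/
@[simp] theorem seq_zero : seq S φ ψ u₀ θ₀ 0 = u₀ := rfl

/-- `u_{k+1} = u_k + S_{θ_k} v_k`. [cite: SaintRaymond1989, Lemma 1, p.220] -/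
theorem seq_succ (k : ℕ) :
    seq S φ ψ u₀ θ₀ (k + 1) = seq S φ ψ u₀ θ₀ k + S (theta θ₀ k) (incr S φ ψ u₀ θ₀ k) := rfl

/-- `u_{k+1} - u_k = S_{θ_k} v_k`. [cite: SaintRaymond1989, Lemma 1, p.220] -/
theorem seq_succ_sub (k : ℕ) :
    seq S φ ψ u₀ θ₀ (k + 1) - seq S φ ψ u₀ θ₀ k = S (theta θ₀ k) (incr S φ ψ u₀ θ₀ k) := by
  rw [seq_succ]; abel

/-- `|u_{m+i} - u_m|_s ≤ Σ_{j<i} |S_{θ_{m+j}} v_{m+j}|_s` (telescoping, cf. (11) p.222).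
[cite: SaintRaymond1989, (11), p.222] -/
theorem apply_seq_sub_le (p : ℕ → AddGroupSeminorm E) (s m i : ℕ) :
    p s (seq S φ ψ u₀ θ₀ (m + i) - seq S φ ψ u₀ θ₀ m) ≤
      ∑ j ∈ range i, p s (S (theta θ₀ (m + j)) (incr S φ ψ u₀ θ₀ (m + j))) := by
  induction i with
  | zero => simp
  | succ i ih =>
    rw [sum_range_succ, ← Nat.add_assoc, seq_succ,
      show seq S φ ψ u₀ θ₀ (m + i) + S (theta θ₀ (m + i)) (incr S φ ψ u₀ θ₀ (m + i)) -
          seq S φ ψ u₀ θ₀ m = (seq S φ ψ u₀ θ₀ (m + i) - seq S φ ψ u₀ θ₀ m) +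
          S (theta θ₀ (m + i)) (incr S φ ψ u₀ θ₀ (m + i)) by abel]
    exact (map_add_le_add _ _ _).trans (add_le_add ih le_rfl)

end Scheme

/-! ## §3 Lemma 1 (the three inductive estimates (i)ₖ, (ii)ₖ, (iii)ₖ) -/

section MainProof

variable [AddCommGroup F]
variable {p : ℕ → AddGroupSeminorm E} {q : ℕ → AddGroupSeminorm F} {S : ℝ → E → E} {φ : E → F}
  {φ' : E → E →+ F} {ψ : E → F → E} {u₀ : E} {d : ℕ} {δ C₁ C₂ : ℝ} {C : ℕ → ℝ}
  {Csm : ℕ → ℕ → ℝ} {M θ₀ : ℝ}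

local notation "𝓊" => seq S φ ψ u₀ θ₀
local notation "𝓋" => incr S φ ψ u₀ θ₀
local notation "ϑ" => theta θ₀

/-- The running hypotheses of Lemma 1: the printed hypotheses, `|u₀|_D ≤ M`, and the choice of
`θ₀` at least the explicit `theta0` (p.220: "for sufficiently large `θ₀`").
[cite: SaintRaymond1989, Lemma 1, p.220] -/
structure Running (p : ℕ → AddGroupSeminorm E) (q : ℕ → AddGroupSeminorm F)
    (S : ℝ → E → E) (φ : E → F) (φ' : E → E →+ F) (ψ : E → F → E) (u₀ : E)
    (d : ℕ) (δ C₁ C₂ : ℝ) (C : ℕ → ℝ) (Csm : ℕ → ℕ → ℝ) (M θ₀ : ℝ) : Prop where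
  hyp : Hypotheses p q S φ φ' ψ u₀ d δ C₁ C₂ C Csm
  norm_u₀ : p (D d) u₀ ≤ M
  theta0_le : theta0 d δ M C₁ C₂ C Csm ≤ θ₀
  /-- Lemma 1's smallness hypothesis "`‖φ(u₀)‖_{2d} ≤ θ₀^{-4}`" -/
  small : q (2 * d) (φ u₀) ≤ θ₀ ^ (-(4 : ℝ))

variable (R : Running p q S φ φ' ψ u₀ d δ C₁ C₂ C Csm M θ₀)
include R

/-- [cite: SaintRaymond1989, p.220] -/
theorem Running.sixteen_le : 16 ≤ θ₀ := (sixteen_le_theta0 d δ M C₁ C₂ C Csm).trans R.theta0_le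

/-- [cite: SaintRaymond1989, p.220] -/
theorem Running.one_le : 1 ≤ θ₀ := le_trans (by norm_num) R.sixteen_le

/-- [cite: SaintRaymond1989, (5), p.220] -/
theorem Running.theta_pos (k : ℕ) : 0 < ϑ k := SaintRaymond.theta_pos R.one_le k

/-- `θ_k > 1`, so `S_{θ_k}` and (4) apply. [cite: SaintRaymond1989, (5), p.220] -/
theorem Running.one_lt_theta (k : ℕ) : 1 < ϑ k :=
  lt_of_lt_of_le (by norm_num) (R.sixteen_le.trans (le_theta R.one_le k))

/-- [cite: SaintRaymond1989, (5), p.220] -/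
theorem Running.one_le_theta (k : ℕ) : 1 ≤ ϑ k := (R.one_lt_theta k).le

/-- [cite: SaintRaymond1989, p.219] -/
theorem Running.δ_pos : 0 < δ := R.hyp.δ_pos

/-- [cite: SaintRaymond1989, (7), p.221] -/
theorem Running.V₀_nonneg : 0 ≤ V₀ d δ M C := by
  unfold V₀; have := R.hyp.C_nonneg d; have := ((apply_nonneg (p (D d)) u₀).trans R.norm_u₀); have := R.δ_pos; positivity

/-- [cite: SaintRaymond1989, (9), p.221] -/
theorem Running.W_nonneg (t : ℕ) : 0 ≤ W d C t := by
  unfold W; have := R.hyp.C_nonneg t; have := R.hyp.C_nonneg (t + d); positivity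

/-- [cite: SaintRaymond1989, (iii), p.220] -/
theorem Running.one_le_U (t : ℕ) : 1 ≤ U d C Csm t := by
  unfold U; have := R.hyp.Csm_nonneg (t + 2 * d) t; have := R.W_nonneg t; nlinarith

/-- [cite: SaintRaymond1989, (8), p.221] -/
theorem Running.V₁_nonneg : 0 ≤ V₁ d M C := by
  unfold V₁; have := R.W_nonneg (T d); have := ((apply_nonneg (p (D d)) u₀).trans R.norm_u₀); positivity

/-- [cite: SaintRaymond1989, (ii), p.220] -/
theorem Running.V_nonneg : 0 ≤ V d δ M C Csm := by
  unfold V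
  have := R.hyp.Csm_nonneg (3 * d + 3) d; have := R.hyp.Csm_nonneg (3 * d + 3) (T d)
  have := R.V₀_nonneg; have := R.V₁_nonneg; positivity

/-- [cite: SaintRaymond1989, p.222] -/
theorem Running.C₀_nonneg : 0 ≤ C₀ d δ M C₁ C₂ C Csm := by
  unfold C₀
  have := R.hyp.Csm_nonneg (3 * d) (3 * d + 3); have := R.hyp.C₁_nonneg; have := R.hyp.C₂_nonneg
  have := R.V_nonneg; positivity

/-- `θ_k^a θ_k^b = θ_k^{a+b}`. [folklore] -/
theorem Running.rpow_mul_rpow (k : ℕ) (a b : ℝ) : ϑ k ^ a * ϑ k ^ b = ϑ k ^ (a + b) :=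
  (Real.rpow_add (R.theta_pos k) a b).symm

/-- `(i)ₖ` of Lemma 1, in the quantitative form the proof actually yields:
`|u_k - u₀|_{3d} ≤ δ/128 (< δ)` and `‖φ(u_k)‖_{2d} ≤ θ_k^{-4}`.
[cite: SaintRaymond1989, Lemma 1 (i), p.220; (11) p.222] -/
def Good (k : ℕ) : Prop :=
  p (3 * d) (𝓊 k - u₀) ≤ δ / 128 ∧ q (2 * d) (φ (𝓊 k)) ≤ ϑ k ^ (-(4 : ℝ))

omit R in
/-- `(i)ₖ` puts `u_k` in the ball of (1). [cite: SaintRaymond1989, Lemma 1 (i), p.220] -/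
theorem Good.ball (hR : Running p q S φ φ' ψ u₀ d δ C₁ C₂ C Csm M θ₀) {k : ℕ}
    (hk : Good (p := p) (q := q) (S := S) (φ := φ) (ψ := ψ) (u₀ := u₀) (d := d) (δ := δ)
      (θ₀ := θ₀) k) :
    p (3 * d) (𝓊 k - u₀) < δ :=
  lt_of_le_of_lt hk.1 (by linarith [hR.δ_pos])

/-- (7): `|v_k|_d ≤ V₀ θ_k^{-4}`. [cite: SaintRaymond1989, (7), p.221] -/
theorem Running.lem7 {k : ℕ} (hk : Good (p := p) (q := q) (S := S) (φ := φ) (ψ := ψ) (u₀ := u₀)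
      (d := d) (δ := δ) (θ₀ := θ₀) k) :
    p d (𝓋 k) ≤ V₀ d δ M C * ϑ k ^ (-(4 : ℝ)) := by
  have hball := hk.ball R
  have h1 := R.hyp.tame_inv (𝓊 k) hball d le_rfl (φ (𝓊 k))
  rw [show d + d = 2 * d by ring] at h1
  have hu : p (2 * d) (𝓊 k) ≤ δ + M := by
    have h2 : p (2 * d) (𝓊 k) ≤ p (2 * d) (𝓊 k - u₀) + p (2 * d) u₀ := by
      have := map_add_le_add (p (2 * d)) (𝓊 k - u₀) u₀
      rwa [sub_add_cancel] at this
    have h3 : p (2 * d) (𝓊 k - u₀) ≤ δ / 128 :=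
      (R.hyp.p_mono (2 * d) (3 * d) (by omega) _).trans hk.1
    have h4 : p (2 * d) u₀ ≤ M :=
      (R.hyp.p_mono (2 * d) (D d) (by unfold D; omega) _).trans R.norm_u₀
    linarith [R.δ_pos]
  have hv : p d (𝓋 k) = p d (ψ (𝓊 k) (φ (𝓊 k))) := by
    simp only [incr, map_neg_eq_map]
  calc p d (𝓋 k) = p d (ψ (𝓊 k) (φ (𝓊 k))) := hv
    _ ≤ C d * (q (2 * d) (φ (𝓊 k)) + p (2 * d) (𝓊 k) * q (2 * d) (φ (𝓊 k))) := h1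
    _ = C d * ((1 + p (2 * d) (𝓊 k)) * q (2 * d) (φ (𝓊 k))) := by ring
    _ ≤ C d * ((1 + δ + M) * ϑ k ^ (-(4 : ℝ))) := by
        apply mul_le_mul_of_nonneg_left _ (R.hyp.C_nonneg d)
        exact mul_le_mul (by linarith) hk.2 (apply_nonneg _ _) (by linarith [R.δ_pos, ((apply_nonneg (p (D d)) u₀).trans R.norm_u₀)])
    _ = V₀ d δ M C * ϑ k ^ (-(4 : ℝ)) := by unfold V₀; ring

/-- (9): `|v_k|_t ≤ W_t (1 + |u_k|_{t+2d})` for `t ≥ d`. [cite: SaintRaymond1989, (9), p.221] -/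
theorem Running.lem9 {k : ℕ} (hk : Good (p := p) (q := q) (S := S) (φ := φ) (ψ := ψ) (u₀ := u₀)
      (d := d) (δ := δ) (θ₀ := θ₀) k) (t : ℕ) (ht : d ≤ t) :
    p t (𝓋 k) ≤ W d C t * (1 + p (t + 2 * d) (𝓊 k)) := by
  have hball := hk.ball R
  have h1 := R.hyp.tame_inv (𝓊 k) hball t ht (φ (𝓊 k))
  have h2 := R.hyp.tame (𝓊 k) hball (t + d) (by omega)
  rw [show t + d + d = t + 2 * d by ring] at h2
  have h3 : q (2 * d) (φ (𝓊 k)) ≤ 1 :=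
    hk.2.trans (Real.rpow_le_one_of_one_le_of_nonpos (R.one_le_theta k) (by norm_num))
  have h4 : p (t + d) (𝓊 k) ≤ p (t + 2 * d) (𝓊 k) := R.hyp.p_mono _ _ (by omega) _
  have hP := apply_nonneg (p (t + 2 * d)) (𝓊 k)
  have hPq : p (t + d) (𝓊 k) * q (2 * d) (φ (𝓊 k)) ≤ (1 + p (t + 2 * d) (𝓊 k)) * 1 :=
    mul_le_mul (by linarith) h3 (apply_nonneg _ _) (by linarith)
  have hv : p t (𝓋 k) = p t (ψ (𝓊 k) (φ (𝓊 k))) := by simp only [incr, map_neg_eq_map]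
  calc p t (𝓋 k) = p t (ψ (𝓊 k) (φ (𝓊 k))) := hv
    _ ≤ C t * (q (t + d) (φ (𝓊 k)) + p (t + d) (𝓊 k) * q (2 * d) (φ (𝓊 k))) := h1
    _ ≤ C t * (C (t + d) * (1 + p (t + 2 * d) (𝓊 k)) + (1 + p (t + 2 * d) (𝓊 k)) * 1) :=
        mul_le_mul_of_nonneg_left (add_le_add h2 hPq) (R.hyp.C_nonneg t)
    _ = W d C t * (1 + p (t + 2 * d) (𝓊 k)) := by unfold W; ring

/-- `(iii)ₖ`: `1 + |u_{k+1}|_{t+2d} ≤ U_t θ_k^{2d} (1 + |u_k|_{t+2d})`, `t ≥ d`.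
[cite: SaintRaymond1989, Lemma 1 (iii), p.220; proof p.222] -/
theorem Running.lemiii {k : ℕ} (hk : Good (p := p) (q := q) (S := S) (φ := φ) (ψ := ψ)
      (u₀ := u₀) (d := d) (δ := δ) (θ₀ := θ₀) k) (t : ℕ) (ht : d ≤ t) :
    1 + p (t + 2 * d) (𝓊 (k + 1)) ≤
      U d C Csm t * ϑ k ^ (2 * (d : ℝ)) * (1 + p (t + 2 * d) (𝓊 k)) := by
  have h1 : p (t + 2 * d) (𝓊 (k + 1)) ≤
      p (t + 2 * d) (𝓊 k) + p (t + 2 * d) (S (ϑ k) (𝓋 k)) := by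
    rw [seq_succ]; exact map_add_le_add _ _ _
  have h2 := R.hyp.smooth_le (ϑ k) (R.one_lt_theta k) (t + 2 * d) t (by omega) (𝓋 k)
  rw [show ((t + 2 * d : ℕ) : ℝ) - (t : ℝ) = 2 * (d : ℝ) by push_cast; ring] at h2
  have h3 := R.lem9 hk t ht
  have hθ : 1 ≤ ϑ k ^ (2 * (d : ℝ)) := Real.one_le_rpow (R.one_le_theta k) (by positivity)
  have hCsm := R.hyp.Csm_nonneg (t + 2 * d) t
  have hW := R.W_nonneg t
  have hP := apply_nonneg (p (t + 2 * d)) (𝓊 k)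
  have h4 : Csm (t + 2 * d) t * ϑ k ^ (2 * (d : ℝ)) * p t (𝓋 k) ≤
      Csm (t + 2 * d) t * ϑ k ^ (2 * (d : ℝ)) * (W d C t * (1 + p (t + 2 * d) (𝓊 k))) :=
    mul_le_mul_of_nonneg_left h3 (by positivity)
  have h5 : 1 + p (t + 2 * d) (𝓊 k) ≤ ϑ k ^ (2 * (d : ℝ)) * (1 + p (t + 2 * d) (𝓊 k)) :=
    le_mul_of_one_le_left (by linarith) hθ
  calc 1 + p (t + 2 * d) (𝓊 (k + 1))
      ≤ 1 + p (t + 2 * d) (𝓊 k) +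
          Csm (t + 2 * d) t * ϑ k ^ (2 * (d : ℝ)) * (W d C t * (1 + p (t + 2 * d) (𝓊 k))) := by
        linarith
    _ = (1 + p (t + 2 * d) (𝓊 k)) +
          Csm (t + 2 * d) t * W d C t * ϑ k ^ (2 * (d : ℝ)) * (1 + p (t + 2 * d) (𝓊 k)) := by ring
    _ ≤ ϑ k ^ (2 * (d : ℝ)) * (1 + p (t + 2 * d) (𝓊 k)) +
          Csm (t + 2 * d) t * W d C t * ϑ k ^ (2 * (d : ℝ)) * (1 + p (t + 2 * d) (𝓊 k)) := by
        linarith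
    _ = U d C Csm t * ϑ k ^ (2 * (d : ℝ)) * (1 + p (t + 2 * d) (𝓊 k)) := by unfold U; ring

/-- (10): `1 + |u_j|_{T+2d} ≤ (1 + |u₀|_{T+2d}) θ_j^N` for `j ≤ k+1`, by induction from `(iii)_j`,
`j ≤ k`, using `θ₀ ≥ U_T` and `N = 4(2d+1)`. [cite: SaintRaymond1989, (10), p.221] -/
theorem Running.lem10 {k : ℕ} (hG : ∀ j, j ≤ k → Good (p := p) (q := q) (S := S) (φ := φ) (ψ := ψ)
      (u₀ := u₀) (d := d) (δ := δ) (θ₀ := θ₀) j) :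
    ∀ j, j ≤ k + 1 → 1 + p (D d) (𝓊 j) ≤ (1 + M) * ϑ j ^ (N d : ℝ) := by
  intro j
  induction j with
  | zero =>
    intro _
    have h1 : 1 ≤ ϑ 0 ^ (N d : ℝ) := Real.one_le_rpow (R.one_le_theta 0) (Nat.cast_nonneg _)
    have h2 : 1 + p (D d) (𝓊 0) ≤ 1 + M := by rw [seq_zero]; linarith [R.norm_u₀]
    exact h2.trans (le_mul_of_one_le_right (by linarith [((apply_nonneg (p (D d)) u₀).trans R.norm_u₀)]) h1)
  | succ j ih =>
    intro hj
    have hj' : j ≤ k := by omega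
    have hiii := R.lemiii (hG j hj') (T d) (by unfold T; omega)
    change 1 + p (D d) (𝓊 (j + 1)) ≤ U d C Csm (T d) * ϑ j ^ (2 * (d : ℝ)) * (1 + p (D d) (𝓊 j))
      at hiii
    have hU : U d C Csm (T d) ≤ ϑ j :=
      ((U_le_theta0 d δ M C₁ C₂ C Csm).trans R.theta0_le).trans (le_theta R.one_le j)
    have hU0 : 0 ≤ U d C Csm (T d) := zero_le_one.trans (R.one_le_U (T d))
    have hM1 : 0 ≤ 1 + M := by linarith [((apply_nonneg (p (D d)) u₀).trans R.norm_u₀)]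
    have hpow0 : 0 ≤ ϑ j ^ (2 * (d : ℝ)) := Real.rpow_nonneg (R.theta_pos j).le _
    have hpowN : 0 ≤ ϑ j ^ (N d : ℝ) := Real.rpow_nonneg (R.theta_pos j).le _
    calc 1 + p (D d) (𝓊 (j + 1))
        ≤ U d C Csm (T d) * ϑ j ^ (2 * (d : ℝ)) * (1 + p (D d) (𝓊 j)) := hiii
      _ ≤ U d C Csm (T d) * ϑ j ^ (2 * (d : ℝ)) * ((1 + M) * ϑ j ^ (N d : ℝ)) :=
          mul_le_mul_of_nonneg_left (ih (by omega)) (by positivity)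
      _ ≤ ϑ j * ϑ j ^ (2 * (d : ℝ)) * ((1 + M) * ϑ j ^ (N d : ℝ)) := by gcongr
      _ = (1 + M) * (ϑ j ^ (1 : ℝ) * ϑ j ^ (2 * (d : ℝ)) * ϑ j ^ (N d : ℝ)) := by
          rw [Real.rpow_one]; ring
      _ = (1 + M) * ϑ (j + 1) ^ (N d : ℝ) := by
          rw [R.rpow_mul_rpow, R.rpow_mul_rpow, theta_succ_rpow R.one_le, five_quarters_N]
          congr 2; ring

/-- `(ii)ⱼ`, `j ≤ k`: `|v_j|_{3d+3} ≤ V θ_j^{-3}`, by interpolation (with the smoothing operators at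
`Θ_j = θ_j^{1/(2d+3)}`) between (7) and (8) = (9)+(10) at `T`.
[cite: SaintRaymond1989, Lemma 1 (ii), p.220; proof p.221] -/
theorem Running.lemii {k : ℕ} (hG : ∀ j, j ≤ k → Good (p := p) (q := q) (S := S) (φ := φ) (ψ := ψ)
      (u₀ := u₀) (d := d) (δ := δ) (θ₀ := θ₀) j) {j : ℕ} (hj : j ≤ k) :
    p (3 * d + 3) (𝓋 j) ≤ V d δ M C Csm * ϑ j ^ (-(3 : ℝ)) := by
  have hθpos := R.theta_pos j
  set Θ : ℝ := ϑ j ^ ((1 : ℝ) / (2 * d + 3)) with hΘ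
  have hΘ1 : 1 < Θ := Real.one_lt_rpow (R.one_lt_theta j) (by positivity)
  have hd3 : (2 * (d : ℝ) + 3) ≠ 0 := by positivity
  have hexp1 : Θ ^ (((3 * d + 3 : ℕ) : ℝ) - (d : ℝ)) = ϑ j := by
    rw [hΘ, ← Real.rpow_mul hθpos.le]
    rw [show (1 : ℝ) / (2 * d + 3) * (((3 * d + 3 : ℕ) : ℝ) - (d : ℝ)) = 1 by
      field_simp; push_cast; ring]
    exact Real.rpow_one _
  have hexp2 : Θ ^ (((3 * d + 3 : ℕ) : ℝ) - (T d : ℝ)) = ϑ j ^ (-((N d : ℝ) + 3)) := by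
    rw [hΘ, ← Real.rpow_mul hθpos.le]
    congr 1
    unfold T; push_cast; field_simp; ring
  have h1 := R.hyp.smooth_le Θ hΘ1 (3 * d + 3) d (by omega) (𝓋 j)
  have h2 := R.hyp.sub_smooth_le Θ hΘ1 (3 * d + 3) (T d) (three_d_three_le_T d) (𝓋 j)
  rw [hexp1] at h1
  rw [hexp2] at h2
  have hsplit : p (3 * d + 3) (𝓋 j) ≤
      p (3 * d + 3) (S Θ (𝓋 j)) + p (3 * d + 3) (𝓋 j - S Θ (𝓋 j)) := by
    have h := map_add_le_add (p (3 * d + 3)) (S Θ (𝓋 j)) (𝓋 j - S Θ (𝓋 j))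
    rwa [add_sub_cancel] at h
  have h7 := R.lem7 (hG j hj)
  have h9 := R.lem9 (hG j hj) (T d) (by unfold T; omega)
  change p (T d) (𝓋 j) ≤ W d C (T d) * (1 + p (D d) (𝓊 j)) at h9
  have h10 := R.lem10 (k := k) hG j (by omega)
  have hCsm1 := R.hyp.Csm_nonneg (3 * d + 3) d
  have hCsm2 := R.hyp.Csm_nonneg (3 * d + 3) (T d)
  have hW := R.W_nonneg (T d)
  have hM1 : 0 ≤ 1 + M := by linarith [((apply_nonneg (p (D d)) u₀).trans R.norm_u₀)]
  have hA : p (3 * d + 3) (S Θ (𝓋 j)) ≤ Csm (3 * d + 3) d * V₀ d δ M C * ϑ j ^ (-(3 : ℝ)) :=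
    calc p (3 * d + 3) (S Θ (𝓋 j)) ≤ Csm (3 * d + 3) d * ϑ j * p d (𝓋 j) := h1
      _ ≤ Csm (3 * d + 3) d * ϑ j * (V₀ d δ M C * ϑ j ^ (-(4 : ℝ))) :=
          mul_le_mul_of_nonneg_left h7 (by positivity)
      _ = Csm (3 * d + 3) d * V₀ d δ M C * (ϑ j ^ (1 : ℝ) * ϑ j ^ (-(4 : ℝ))) := by
          rw [Real.rpow_one]; ring
      _ = Csm (3 * d + 3) d * V₀ d δ M C * ϑ j ^ (-(3 : ℝ)) := by
          rw [R.rpow_mul_rpow]; norm_num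
  have hB : p (3 * d + 3) (𝓋 j - S Θ (𝓋 j)) ≤ Csm (3 * d + 3) (T d) * V₁ d M C * ϑ j ^ (-(3 : ℝ)) :=
    calc p (3 * d + 3) (𝓋 j - S Θ (𝓋 j))
        ≤ Csm (3 * d + 3) (T d) * ϑ j ^ (-((N d : ℝ) + 3)) * p (T d) (𝓋 j) := h2
      _ ≤ Csm (3 * d + 3) (T d) * ϑ j ^ (-((N d : ℝ) + 3)) *
            (W d C (T d) * ((1 + M) * ϑ j ^ (N d : ℝ))) := by
          apply mul_le_mul_of_nonneg_left _ (by positivity)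
          exact h9.trans (mul_le_mul_of_nonneg_left h10 hW)
      _ = Csm (3 * d + 3) (T d) * V₁ d M C * (ϑ j ^ (-((N d : ℝ) + 3)) * ϑ j ^ (N d : ℝ)) := by
          unfold V₁; ring
      _ = Csm (3 * d + 3) (T d) * V₁ d M C * ϑ j ^ (-(3 : ℝ)) := by
          rw [R.rpow_mul_rpow]; congr 2; ring
  calc p (3 * d + 3) (𝓋 j) ≤ _ := hsplit
    _ ≤ Csm (3 * d + 3) d * V₀ d δ M C * ϑ j ^ (-(3 : ℝ)) +
        Csm (3 * d + 3) (T d) * V₁ d M C * ϑ j ^ (-(3 : ℝ)) := add_le_add hA hB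
    _ = V d δ M C Csm * ϑ j ^ (-(3 : ℝ)) := by unfold V; ring

/-- `(i)₀`. [cite: SaintRaymond1989, proof of Lemma 1, p.221 ("The property (i)₀ is true by
assumption")] -/
theorem Running.good_zero :
    Good (p := p) (q := q) (S := S) (φ := φ) (ψ := ψ) (u₀ := u₀) (d := d) (δ := δ) (θ₀ := θ₀) 0 := by
  constructor
  · simp only [seq_zero, sub_self, map_zero]; linarith [R.δ_pos]
  · simpa only [seq_zero, theta_zero] using R.small

/-- The bound `|S_{θ_j} v_j|_{3d} ≤ C_{3d,3d} V θ_j^{-3}` used in (11). [cite: SaintRaymond1989,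
(11), p.222] -/
theorem Running.smooth_incr_le {k : ℕ} (hG : ∀ j, j ≤ k → Good (p := p) (q := q) (S := S) (φ := φ)
      (ψ := ψ) (u₀ := u₀) (d := d) (δ := δ) (θ₀ := θ₀) j) {j : ℕ} (hj : j ≤ k) :
    p (3 * d) (S (ϑ j) (𝓋 j)) ≤ Csm (3 * d) (3 * d) * V d δ M C Csm * ϑ j ^ (-(3 : ℝ)) := by
  have h1 := R.hyp.smooth_le (ϑ j) (R.one_lt_theta j) (3 * d) (3 * d) le_rfl (𝓋 j)
  rw [sub_self, Real.rpow_zero, mul_one] at h1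
  have h2 : p (3 * d) (𝓋 j) ≤ p (3 * d + 3) (𝓋 j) := R.hyp.p_mono _ _ (by omega) _
  calc p (3 * d) (S (ϑ j) (𝓋 j)) ≤ Csm (3 * d) (3 * d) * p (3 * d) (𝓋 j) := h1
    _ ≤ Csm (3 * d) (3 * d) * (V d δ M C Csm * ϑ j ^ (-(3 : ℝ))) :=
        mul_le_mul_of_nonneg_left (h2.trans (R.lemii hG hj)) (R.hyp.Csm_nonneg _ _)
    _ = Csm (3 * d) (3 * d) * V d δ M C Csm * ϑ j ^ (-(3 : ℝ)) := by ring

/-- The induction step `(i)ₖ, (ii)ⱼ (j ≤ k) ⇒ (i)ₖ₊₁`: (11) for the first half, the Taylor formula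
of p.222 for the second half. [cite: SaintRaymond1989, proof of (i), p.222] -/
theorem Running.good_succ {k : ℕ} (hG : ∀ j, j ≤ k → Good (p := p) (q := q) (S := S) (φ := φ)
      (ψ := ψ) (u₀ := u₀) (d := d) (δ := δ) (θ₀ := θ₀) j) :
    Good (p := p) (q := q) (S := S) (φ := φ) (ψ := ψ) (u₀ := u₀) (d := d) (δ := δ) (θ₀ := θ₀)
      (k + 1) := by
  have hV := R.V_nonneg
  have hCsm33 := R.hyp.Csm_nonneg (3 * d) (3 * d)
  have hCsm36 := R.hyp.Csm_nonneg (3 * d) (3 * d + 3)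
  have hδ := R.δ_pos
  have h16 := R.sixteen_le
  have hθ0 : 0 < θ₀ := by linarith
  -- (11): the first half of (i)ₖ₊₁
  have hsum := apply_seq_sub_le S φ ψ u₀ θ₀ p (3 * d) 0 (k + 1)
  simp only [Nat.zero_add, seq_zero] at hsum
  have part1 : p (3 * d) (𝓊 (k + 1) - u₀) ≤ δ / 128 := by
    have hq := (quot_le_theta0 d δ M C₁ C₂ C Csm).trans R.theta0_le
    rw [div_le_iff₀ hδ] at hq
    have hkey : Csm (3 * d) (3 * d) * V d δ M C Csm * θ₀⁻¹ ≤ δ := by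
      rw [← div_eq_mul_inv, div_le_iff₀ hθ0]; linarith
    calc p (3 * d) (𝓊 (k + 1) - u₀) ≤ ∑ j ∈ range (k + 1), p (3 * d) (S (ϑ j) (𝓋 j)) := hsum
      _ ≤ ∑ j ∈ range (k + 1), Csm (3 * d) (3 * d) * V d δ M C Csm * ϑ j ^ (-(3 : ℝ)) :=
          sum_le_sum fun j hj => R.smooth_incr_le hG (by rw [mem_range] at hj; omega)
      _ = Csm (3 * d) (3 * d) * V d δ M C Csm * ∑ j ∈ range (k + 1), ϑ j ^ (-(3 : ℝ)) := by
          rw [mul_sum]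
      _ ≤ Csm (3 * d) (3 * d) * V d δ M C Csm * (2 * θ₀ ^ (-(3 : ℝ))) :=
          mul_le_mul_of_nonneg_left (sum_theta_rpow_neg_three_le h16 _) (by positivity)
      _ ≤ Csm (3 * d) (3 * d) * V d δ M C Csm * (θ₀ ^ (-(1 : ℝ)) / 128) :=
          mul_le_mul_of_nonneg_left (two_rpow_neg_three_le h16) (by positivity)
      _ = Csm (3 * d) (3 * d) * V d δ M C Csm * θ₀⁻¹ / 128 := by rw [Real.rpow_neg_one]; ring
      _ ≤ δ / 128 := by linarith
  -- the second half of (i)ₖ₊₁: Taylor's formula at `u_k` with increment `S_{θ_k} v_k`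
  have hballk : p (3 * d) (𝓊 k - u₀) < δ := (hG k le_rfl).ball R
  have hballk1 : p (3 * d) (𝓊 (k + 1) - u₀) < δ := lt_of_le_of_lt part1 (by linarith)
  have hstep : 𝓊 (k + 1) - 𝓊 k = S (ϑ k) (𝓋 k) := seq_succ_sub S φ ψ u₀ θ₀ k
  have hvk : φ' (𝓊 k) (𝓋 k) = -φ (𝓊 k) := by
    simp only [incr, map_neg, R.hyp.right_inv (𝓊 k) hballk]
  have key : φ (𝓊 (k + 1)) = (φ (𝓊 (k + 1)) - φ (𝓊 k) - φ' (𝓊 k) (𝓊 (k + 1) - 𝓊 k)) +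
      φ' (𝓊 k) (S (ϑ k) (𝓋 k) - 𝓋 k) := by
    rw [hstep, map_sub, hvk]; abel
  have hT := R.hyp.taylor (𝓊 k) (𝓊 (k + 1)) hballk hballk1
  have hD := R.hyp.deriv_le (𝓊 k) hballk (S (ϑ k) (𝓋 k) - 𝓋 k)
  have hii := R.lemii hG le_rfl
  have ha : p (3 * d) (𝓊 (k + 1) - 𝓊 k) ≤ Csm (3 * d) (3 * d) * V d δ M C Csm * ϑ k ^ (-(3 : ℝ)) := by
    rw [hstep]; exact R.smooth_incr_le hG le_rfl
  have hb : p (3 * d) (S (ϑ k) (𝓋 k) - 𝓋 k) ≤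
      Csm (3 * d) (3 * d + 3) * V d δ M C Csm * ϑ k ^ (-(6 : ℝ)) := by
    rw [map_sub_rev]
    have h1 := R.hyp.sub_smooth_le (ϑ k) (R.one_lt_theta k) (3 * d) (3 * d + 3) (by omega) (𝓋 k)
    rw [show ((3 * d : ℕ) : ℝ) - ((3 * d + 3 : ℕ) : ℝ) = -(3 : ℝ) by push_cast; ring] at h1
    have hnn : 0 ≤ Csm (3 * d) (3 * d + 3) * ϑ k ^ (-(3 : ℝ)) :=
      mul_nonneg hCsm36 (Real.rpow_nonneg (R.theta_pos k).le _)
    calc p (3 * d) (𝓋 k - S (ϑ k) (𝓋 k))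
        ≤ Csm (3 * d) (3 * d + 3) * ϑ k ^ (-(3 : ℝ)) * p (3 * d + 3) (𝓋 k) := h1
      _ ≤ Csm (3 * d) (3 * d + 3) * ϑ k ^ (-(3 : ℝ)) * (V d δ M C Csm * ϑ k ^ (-(3 : ℝ))) :=
          mul_le_mul_of_nonneg_left hii hnn
      _ = Csm (3 * d) (3 * d + 3) * V d δ M C Csm * (ϑ k ^ (-(3 : ℝ)) * ϑ k ^ (-(3 : ℝ))) := by
          ring
      _ = Csm (3 * d) (3 * d + 3) * V d δ M C Csm * ϑ k ^ (-(6 : ℝ)) := by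
          rw [R.rpow_mul_rpow]; norm_num
  have hsq : (ϑ k ^ (-(3 : ℝ))) ^ 2 = ϑ k ^ (-(6 : ℝ)) := by
    rw [sq, R.rpow_mul_rpow]; norm_num
  have hθ6 : q (2 * d) (φ (𝓊 (k + 1))) ≤ C₀ d δ M C₁ C₂ C Csm * ϑ k ^ (-(6 : ℝ)) := by
    calc q (2 * d) (φ (𝓊 (k + 1)))
        = q (2 * d) ((φ (𝓊 (k + 1)) - φ (𝓊 k) - φ' (𝓊 k) (𝓊 (k + 1) - 𝓊 k)) +
            φ' (𝓊 k) (S (ϑ k) (𝓋 k) - 𝓋 k)) := congrArg (q (2 * d)) key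
      _ ≤ q (2 * d) (φ (𝓊 (k + 1)) - φ (𝓊 k) - φ' (𝓊 k) (𝓊 (k + 1) - 𝓊 k)) +
            q (2 * d) (φ' (𝓊 k) (S (ϑ k) (𝓋 k) - 𝓋 k)) := map_add_le_add _ _ _
      _ ≤ C₂ * p (3 * d) (𝓊 (k + 1) - 𝓊 k) ^ 2 + C₁ * p (3 * d) (S (ϑ k) (𝓋 k) - 𝓋 k) :=
          add_le_add hT hD
      _ ≤ C₂ * (Csm (3 * d) (3 * d) * V d δ M C Csm * ϑ k ^ (-(3 : ℝ))) ^ 2 +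
            C₁ * (Csm (3 * d) (3 * d + 3) * V d δ M C Csm * ϑ k ^ (-(6 : ℝ))) := by
          apply add_le_add
          · exact mul_le_mul_of_nonneg_left (pow_le_pow_left₀ (apply_nonneg _ _) ha 2)
              R.hyp.C₂_nonneg
          · exact mul_le_mul_of_nonneg_left hb R.hyp.C₁_nonneg
      _ = C₀ d δ M C₁ C₂ C Csm * ϑ k ^ (-(6 : ℝ)) := by
          unfold C₀; rw [mul_pow, hsq]; ring
  have part2 : q (2 * d) (φ (𝓊 (k + 1))) ≤ ϑ (k + 1) ^ (-(4 : ℝ)) := by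
    rw [theta_succ_rpow R.one_le, show (5 : ℝ) / 4 * (-(4 : ℝ)) = -(5 : ℝ) by norm_num]
    have hC0 : C₀ d δ M C₁ C₂ C Csm ≤ ϑ k :=
      ((C₀_le_theta0 d δ M C₁ C₂ C Csm).trans R.theta0_le).trans (le_theta R.one_le k)
    calc q (2 * d) (φ (𝓊 (k + 1))) ≤ C₀ d δ M C₁ C₂ C Csm * ϑ k ^ (-(6 : ℝ)) := hθ6
      _ ≤ ϑ k * ϑ k ^ (-(6 : ℝ)) :=
          mul_le_mul_of_nonneg_right hC0 (Real.rpow_nonneg (R.theta_pos k).le _)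
      _ = ϑ k ^ (1 : ℝ) * ϑ k ^ (-(6 : ℝ)) := by rw [Real.rpow_one]
      _ = ϑ k ^ (-(5 : ℝ)) := by rw [R.rpow_mul_rpow]; norm_num
  exact ⟨part1, part2⟩

/-- **Lemma 1** [cite: SaintRaymond1989, Lemma 1, p.220]: all the `(i)ₖ` hold (and with them, by
`lemii`/`lemiii`, all the `(ii)ₖ`, `(iii)ₖ`). -/
theorem Running.good_le (k : ℕ) : ∀ j, j ≤ k →
    Good (p := p) (q := q) (S := S) (φ := φ) (ψ := ψ) (u₀ := u₀) (d := d) (δ := δ) (θ₀ := θ₀) j := by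
  induction k with
  | zero =>
    intro j hj
    obtain rfl : j = 0 := by omega
    exact R.good_zero
  | succ k ih =>
    intro j hj
    rcases Nat.lt_or_ge j (k + 1) with h | h
    · exact ih j (by omega)
    · obtain rfl : j = k + 1 := by omega
      exact R.good_succ ih

/-- **Lemma 1 (i)ₖ** for every `k`. [cite: SaintRaymond1989, Lemma 1, p.220] -/
theorem Running.good (k : ℕ) :
    Good (p := p) (q := q) (S := S) (φ := φ) (ψ := ψ) (u₀ := u₀) (d := d) (δ := δ) (θ₀ := θ₀) k :=
  R.good_le k k le_rfl

/-- **Lemma 1 (ii)ₖ** for every `k`. [cite: SaintRaymond1989, Lemma 1, p.220] -/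
theorem Running.incr_le (k : ℕ) : p (3 * d + 3) (𝓋 k) ≤ V d δ M C Csm * ϑ k ^ (-(3 : ℝ)) :=
  R.lemii (R.good_le k) le_rfl

/-! ## §4 Lemma 2 (`|v_k|_s ≤ V_s θ_k^{-3}` for every `s`) and the convergence of the scheme -/

/-- **Lemma 2** [cite: SaintRaymond1989, Lemma 2, p.223]: for every index `s` there is `V_s` with
`|v_k|_s ≤ V_s θ_k^{-3}` for all `k` (for `s ≤ 3d+3` this is `(ii)ₖ`; above, the printed argument:
the sequence `(1 + |u_k|_{t+2d}) θ_k^{-N}` is eventually nonincreasing, hence bounded, which gives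
(12) `|v_k|_t ≤ W θ_k^N`, and one interpolates with `t = s + (s-d)(N+3)`, `Θ = θ_k^{1/(s-d)}`). -/
theorem Running.lemma2 (s : ℕ) : ∃ Vs : ℝ, 0 ≤ Vs ∧ ∀ k, p s (𝓋 k) ≤ Vs * ϑ k ^ (-(3 : ℝ)) := by
  by_cases hs : s ≤ 3 * d + 3
  · exact ⟨V d δ M C Csm, R.V_nonneg, fun k => (R.hyp.p_mono s (3 * d + 3) hs _).trans (R.incr_le k)⟩
  have hds : d < s := by omega
  set t : ℕ := s + (s - d) * (N d + 3) with ht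
  have hst : s ≤ t := by omega
  have hdt : d ≤ t := by omega
  set b : ℕ → ℝ := fun k => (1 + p (t + 2 * d) (𝓊 k)) * ϑ k ^ (-(N d : ℝ)) with hbdef
  have hb_nonneg : ∀ k, 0 ≤ b k := fun k =>
    mul_nonneg (by linarith [apply_nonneg (p (t + 2 * d)) (𝓊 k)])
      (Real.rpow_nonneg (R.theta_pos k).le _)
  -- `b_{k+1} ≤ (U_t / θ_k) b_k`
  have hb : ∀ k, b (k + 1) ≤ U d C Csm t * (ϑ k)⁻¹ * b k := by
    intro k
    have hiii := R.lemiii (R.good k) t hdt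
    have hnn : 0 ≤ ϑ k ^ (-((N d : ℝ) + 2 * d + 1)) := Real.rpow_nonneg (R.theta_pos k).le _
    simp only [hbdef]
    rw [theta_succ_rpow R.one_le, show (5 : ℝ) / 4 * (-(N d : ℝ)) = -((5 : ℝ) / 4 * (N d : ℝ)) by
      ring, five_quarters_N]
    calc (1 + p (t + 2 * d) (𝓊 (k + 1))) * ϑ k ^ (-((N d : ℝ) + 2 * d + 1))
        ≤ (U d C Csm t * ϑ k ^ (2 * (d : ℝ)) * (1 + p (t + 2 * d) (𝓊 k))) *
            ϑ k ^ (-((N d : ℝ) + 2 * d + 1)) := mul_le_mul_of_nonneg_right hiii hnn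
      _ = U d C Csm t * (ϑ k ^ (2 * (d : ℝ)) * ϑ k ^ (-((N d : ℝ) + 2 * d + 1))) *
            (1 + p (t + 2 * d) (𝓊 k)) := by ring
      _ = U d C Csm t * (ϑ k ^ (-(1 : ℝ)) * ϑ k ^ (-(N d : ℝ))) * (1 + p (t + 2 * d) (𝓊 k)) := by
          rw [R.rpow_mul_rpow, R.rpow_mul_rpow]; congr 3; ring
      _ = U d C Csm t * (ϑ k)⁻¹ * ((1 + p (t + 2 * d) (𝓊 k)) * ϑ k ^ (-(N d : ℝ))) := by
          rw [Real.rpow_neg_one]; ring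
  obtain ⟨K, hK⟩ := exists_le_theta R.sixteen_le (U d C Csm t)
  have hmono : ∀ k, K ≤ k → b (k + 1) ≤ b k := by
    intro k hk
    have hU1 : U d C Csm t * (ϑ k)⁻¹ ≤ 1 := by
      rw [mul_inv_le_iff₀ (R.theta_pos k), one_mul]; exact hK k hk
    calc b (k + 1) ≤ U d C Csm t * (ϑ k)⁻¹ * b k := hb k
      _ ≤ 1 * b k := mul_le_mul_of_nonneg_right hU1 (hb_nonneg k)
      _ = b k := one_mul _
  set B : ℝ := ∑ j ∈ range (K + 1), b j with hB
  have hbB : ∀ k, b k ≤ B := by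
    intro k
    rcases Nat.lt_or_ge k (K + 1) with h | h
    · exact single_le_sum (fun j _ => hb_nonneg j) (mem_range.mpr h)
    · have hdec : ∀ n, b (K + n) ≤ b K := by
        intro n
        induction n with
        | zero => simp
        | succ n ih => exact (hmono (K + n) (by omega)).trans ih
      have hk := hdec (k - K)
      rw [show K + (k - K) = k by omega] at hk
      exact hk.trans (single_le_sum (fun j _ => hb_nonneg j) (mem_range.mpr (by omega)))
  have hB0 : 0 ≤ B := sum_nonneg fun j _ => hb_nonneg j
  -- (12)
  have h12 : ∀ k, p t (𝓋 k) ≤ W d C t * B * ϑ k ^ (N d : ℝ) := by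
    intro k
    have h9 := R.lem9 (R.good k) t hdt
    have hbk : 1 + p (t + 2 * d) (𝓊 k) = b k * ϑ k ^ (N d : ℝ) := by
      simp only [hbdef]
      rw [mul_assoc, R.rpow_mul_rpow, neg_add_cancel, Real.rpow_zero, mul_one]
    have hθN : 0 ≤ ϑ k ^ (N d : ℝ) := Real.rpow_nonneg (R.theta_pos k).le _
    calc p t (𝓋 k) ≤ W d C t * (1 + p (t + 2 * d) (𝓊 k)) := h9
      _ = W d C t * (b k * ϑ k ^ (N d : ℝ)) := by rw [hbk]
      _ ≤ W d C t * (B * ϑ k ^ (N d : ℝ)) :=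
          mul_le_mul_of_nonneg_left (mul_le_mul_of_nonneg_right (hbB k) hθN) (R.W_nonneg t)
      _ = W d C t * B * ϑ k ^ (N d : ℝ) := by ring
  have hCsm1 := R.hyp.Csm_nonneg s d
  have hCsm2 := R.hyp.Csm_nonneg s t
  have hW := R.W_nonneg t
  have hV₀ := R.V₀_nonneg
  refine ⟨Csm s d * V₀ d δ M C + Csm s t * (W d C t * B), by positivity, fun k => ?_⟩
  have hθpos := R.theta_pos k
  have hsd : (0 : ℝ) < (s : ℝ) - d := sub_pos.mpr (by exact_mod_cast hds)
  have htcast : (t : ℝ) = s + ((s : ℝ) - d) * ((N d : ℝ) + 3) := by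
    rw [ht]; push_cast [Nat.cast_sub hds.le]; ring
  set Θ : ℝ := ϑ k ^ ((1 : ℝ) / ((s : ℝ) - d)) with hΘ
  have hΘ1 : 1 < Θ := Real.one_lt_rpow (R.one_lt_theta k) (by positivity)
  have hexp1 : Θ ^ ((s : ℝ) - (d : ℝ)) = ϑ k := by
    rw [hΘ, ← Real.rpow_mul hθpos.le,
      show (1 : ℝ) / ((s : ℝ) - d) * ((s : ℝ) - (d : ℝ)) = 1 by field_simp, Real.rpow_one]
  have hexp2 : Θ ^ ((s : ℝ) - (t : ℝ)) = ϑ k ^ (-((N d : ℝ) + 3)) := by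
    rw [hΘ, ← Real.rpow_mul hθpos.le]
    congr 1
    rw [htcast]; field_simp; ring
  have h1 := R.hyp.smooth_le Θ hΘ1 s d hds.le (𝓋 k)
  have h2 := R.hyp.sub_smooth_le Θ hΘ1 s t hst (𝓋 k)
  rw [hexp1] at h1
  rw [hexp2] at h2
  have hsplit : p s (𝓋 k) ≤ p s (S Θ (𝓋 k)) + p s (𝓋 k - S Θ (𝓋 k)) := by
    have h := map_add_le_add (p s) (S Θ (𝓋 k)) (𝓋 k - S Θ (𝓋 k))
    rwa [add_sub_cancel] at h
  have h7 := R.lem7 (R.good k)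
  have hA : p s (S Θ (𝓋 k)) ≤ Csm s d * V₀ d δ M C * ϑ k ^ (-(3 : ℝ)) :=
    calc p s (S Θ (𝓋 k)) ≤ Csm s d * ϑ k * p d (𝓋 k) := h1
      _ ≤ Csm s d * ϑ k * (V₀ d δ M C * ϑ k ^ (-(4 : ℝ))) :=
          mul_le_mul_of_nonneg_left h7 (mul_nonneg hCsm1 hθpos.le)
      _ = Csm s d * V₀ d δ M C * (ϑ k ^ (1 : ℝ) * ϑ k ^ (-(4 : ℝ))) := by rw [Real.rpow_one]; ring
      _ = Csm s d * V₀ d δ M C * ϑ k ^ (-(3 : ℝ)) := by rw [R.rpow_mul_rpow]; norm_num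
  have hBterm : p s (𝓋 k - S Θ (𝓋 k)) ≤ Csm s t * (W d C t * B) * ϑ k ^ (-(3 : ℝ)) :=
    calc p s (𝓋 k - S Θ (𝓋 k)) ≤ Csm s t * ϑ k ^ (-((N d : ℝ) + 3)) * p t (𝓋 k) := h2
      _ ≤ Csm s t * ϑ k ^ (-((N d : ℝ) + 3)) * (W d C t * B * ϑ k ^ (N d : ℝ)) :=
          mul_le_mul_of_nonneg_left (h12 k) (mul_nonneg hCsm2 (Real.rpow_nonneg hθpos.le _))
      _ = Csm s t * (W d C t * B) * (ϑ k ^ (-((N d : ℝ) + 3)) * ϑ k ^ (N d : ℝ)) := by ring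
      _ = Csm s t * (W d C t * B) * ϑ k ^ (-(3 : ℝ)) := by
          rw [R.rpow_mul_rpow]; congr 2; ring
  calc p s (𝓋 k) ≤ _ := hsplit
    _ ≤ Csm s d * V₀ d δ M C * ϑ k ^ (-(3 : ℝ)) + Csm s t * (W d C t * B) * ϑ k ^ (-(3 : ℝ)) :=
        add_le_add hA hBterm
    _ = (Csm s d * V₀ d δ M C + Csm s t * (W d C t * B)) * ϑ k ^ (-(3 : ℝ)) := by ring

/-- The tails of the series `Σ S_{θ_j} v_j` in every seminorm: `|u_{m+i} - u_m|_s ≤ A_s θ_m^{-1}`.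
[cite: SaintRaymond1989, Proof of the theorem, p.223 ("`Σ |S_{θ_j} v_j|_s ≤ C_{s,s} V_s Σ θ_j^{-3}`
… so that the sequence `u_k` is convergent in every `H^s`")] -/
theorem Running.tail_le (s : ℕ) : ∃ A : ℝ, 0 ≤ A ∧ ∀ m i, p s (𝓊 (m + i) - 𝓊 m) ≤ A * (ϑ m)⁻¹ := by
  obtain ⟨Vs, hVs0, hVs⟩ := R.lemma2 s
  have hCsm := R.hyp.Csm_nonneg s s
  refine ⟨2 * Csm s s * Vs, by positivity, fun m i => ?_⟩
  have hm1 : 1 ≤ ϑ m := R.one_le_theta m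
  have hterm : ∀ j, p s (S (ϑ (m + j)) (𝓋 (m + j))) ≤ Csm s s * Vs * ϑ (m + j) ^ (-(3 : ℝ)) := by
    intro j
    have h1 := R.hyp.smooth_le (ϑ (m + j)) (R.one_lt_theta (m + j)) s s le_rfl (𝓋 (m + j))
    rw [sub_self, Real.rpow_zero, mul_one] at h1
    calc p s (S (ϑ (m + j)) (𝓋 (m + j))) ≤ Csm s s * p s (𝓋 (m + j)) := h1
      _ ≤ Csm s s * (Vs * ϑ (m + j) ^ (-(3 : ℝ))) := mul_le_mul_of_nonneg_left (hVs _) hCsm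
      _ = Csm s s * Vs * ϑ (m + j) ^ (-(3 : ℝ)) := by ring
  calc p s (𝓊 (m + i) - 𝓊 m) ≤ ∑ j ∈ range i, p s (S (ϑ (m + j)) (𝓋 (m + j))) :=
        apply_seq_sub_le S φ ψ u₀ θ₀ p s m i
    _ ≤ ∑ j ∈ range i, Csm s s * Vs * ϑ (m + j) ^ (-(3 : ℝ)) := sum_le_sum fun j _ => hterm j
    _ = Csm s s * Vs * ∑ j ∈ range i, ϑ (m + j) ^ (-(3 : ℝ)) := by rw [mul_sum]
    _ ≤ Csm s s * Vs * (2 * ϑ m ^ (-(3 : ℝ))) :=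
        mul_le_mul_of_nonneg_left (sum_theta_rpow_neg_three_tail_le R.sixteen_le m i)
          (by positivity)
    _ ≤ Csm s s * Vs * (2 * ϑ m ^ (-(1 : ℝ))) := by
        apply mul_le_mul_of_nonneg_left _ (by positivity)
        exact mul_le_mul_of_nonneg_left
          (Real.rpow_le_rpow_of_exponent_le hm1 (by norm_num)) (by norm_num)
    _ = 2 * Csm s s * Vs * (ϑ m)⁻¹ := by rw [Real.rpow_neg_one]; ring

/-- `A θ_m^{-1} → 0`: for `A ≥ 0` and `ε > 0`, eventually `A θ_m^{-1} < ε`.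
[cite: SaintRaymond1989, proof of Lemma 2, p.223 ("`θ_k` tends to infinity")] -/
theorem Running.eventually_small {A ε : ℝ} (hA : 0 ≤ A) (hε : 0 < ε) :
    ∃ K : ℕ, ∀ m, K ≤ m → A * (ϑ m)⁻¹ < ε := by
  obtain ⟨K, hK⟩ := exists_le_theta R.sixteen_le (A / ε + 1)
  refine ⟨K, fun m hm => ?_⟩
  have hR : 0 < A / ε + 1 := by positivity
  have hθ := hK m hm
  calc A * (ϑ m)⁻¹ ≤ A * (A / ε + 1)⁻¹ :=
        mul_le_mul_of_nonneg_left (inv_anti₀ hR hθ) hA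
    _ < ε := by
        rw [← div_eq_mul_inv, div_lt_iff₀ hR]
        have : ε * (A / ε + 1) = A + ε := by field_simp
        linarith

/-- The iterates are Cauchy in every seminorm. [cite: SaintRaymond1989, Proof of the theorem, p.223] -/
theorem Running.cauchy (s : ℕ) (ε : ℝ) (hε : 0 < ε) :
    ∃ K : ℕ, ∀ m n : ℕ, K ≤ m → K ≤ n → p s (𝓊 m - 𝓊 n) < ε := by
  obtain ⟨A, hA0, hA⟩ := R.tail_le s
  obtain ⟨K, hK⟩ := R.eventually_small hA0 hε
  refine ⟨K, fun m n hm hn => ?_⟩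
  rcases le_total m n with h | h
  · obtain ⟨i, rfl⟩ := Nat.exists_eq_add_of_le h
    rw [map_sub_rev]
    exact (hA m i).trans_lt (hK m hm)
  · obtain ⟨i, rfl⟩ := Nat.exists_eq_add_of_le h
    exact (hA n i).trans_lt (hK n hn)

end MainProof

/-! ## §5 The theorem -/

/-- **Saint-Raymond's Nash–Moser implicit function theorem** (abstract form of the Remark, p.220).
Printed statement (Theorem, pp.219–220): "Let `φ : H^∞(ℝⁿ) → H^∞(Ω)` … One assumes that there exist
`u₀ ∈ H^∞(ℝⁿ)`, an integer `d > 0`, a real number `δ` and constants `C₁, C₂` and `(C_s)_{s≥d}` such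
that for any `u, v, w ∈ H^∞(ℝⁿ)`, (1) `|u - u₀|_{3d} < δ ⇒ { ∀ s ≥ d, ‖φ(u)‖_s ≤ C_s(1 + |u|_{s+d});
‖φ'(u)v‖_{2d} ≤ C₁|v|_{3d}; ‖φ''(u)(v,w)‖_{2d} ≤ C₂|v|_{3d}|w|_{3d} }` … Moreover, one assumes that
for every `u ∈ H^∞(ℝⁿ)` such that `|u - u₀|_{3d} < δ`, there exists an operator
`ψ(u) : H^∞(Ω) → H^∞(ℝⁿ)` satisfying for any `φ ∈ H^∞(Ω)`, (2) `φ'(u)ψ(u)φ = φ` in `Ω`, and (3)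
`∀ s ≥ d, |ψ(u)φ|_s ≤ C_s(‖φ‖_{s+d} + |u|_{s+d}‖φ‖_{2d})` (the so-called "tame estimate"). Then,
if `‖φ(u₀)‖_{2d}` is sufficiently small (with respect to some upper bound of `1/δ`, `|u₀|_D` and
`(C_s)_{s≤D}` where `D = 16d² + 43d + 24`), there exists a function `u ∈ H^∞(ℝⁿ)` such that
`φ(u) = 0` in `Ω`."  Remark (p.220): the same holds for gradations of Banach spaces with smoothing
operators satisfying (4) and monotone norms.  Here: `E`, `F` graded by the seminorms `p s`, `q s`
(hypotheses `Hypotheses`, sequential completeness `IsComplete p`, and `q (2d)` separating points —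
"norms"), `|u₀|_D ≤ M`, and the explicit smallness `‖φ(u₀)‖_{2d} ≤ threshold d δ M C₁ C₂ C Csm`
(a function of `d, δ, M, C₁, C₂, (C_s), (C_{s,t})` only).  NOTE (audit precision P14): this dependence
list is LONGER than the printed one ("some upper bound of `1/δ`, `|u₀|_D` and `(C_s)_{s≤D}`"): the kernel
threshold also depends on `C₁`, `C₂` (which enter the constants of Lemma 1, p.221) and on the smoothing
constants `C_{s,t}` of (4) (in the print these are fixed once and for all by the ambient `H^s` scale; in the
abstract graded setting of the Remark they are data of the hypothesis `Hypotheses.smooth_le`/`sub_smooth_le`).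
A smallness condition allowed to depend on MORE of the data is a formally WEAKER theorem than the printed
sentence read literally — never a strengthening of the source.  Conclusion: a zero `u` of `φ` in the ball
`|u - u₀|_{3d} < δ` (the print states `φ(u) = 0`; membership in the ball is (11), p.222).  Also
restated as Hintz–Vasy, Acta Math. 220 (2018), Thm 11.1. [cite: SaintRaymond1989, Theorem and
Remark, pp.219–220] -/
theorem exists_zero [AddCommGroup F] {p : ℕ → AddGroupSeminorm E} {q : ℕ → AddGroupSeminorm F}
    {S : ℝ → E → E} {φ : E → F} {φ' : E → E →+ F} {ψ : E → F → E} {u₀ : E} {d : ℕ}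
    {δ C₁ C₂ : ℝ} {C : ℕ → ℝ} {Csm : ℕ → ℕ → ℝ}
    (H : Hypotheses p q S φ φ' ψ u₀ d δ C₁ C₂ C Csm) (hE : IsComplete p)
    (hq : ∀ w : F, q (2 * d) w = 0 → w = 0) {M : ℝ} (hM : p (D d) u₀ ≤ M)
    (hsmall : q (2 * d) (φ u₀) ≤ threshold d δ M C₁ C₂ C Csm) :
    ∃ u : E, p (3 * d) (u - u₀) < δ ∧ φ u = 0 := by
  set θ₀ : ℝ := theta0 d δ M C₁ C₂ C Csm with hθ₀
  have R : Running p q S φ φ' ψ u₀ d δ C₁ C₂ C Csm M θ₀ := ⟨H, hM, le_rfl, hsmall⟩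
  obtain ⟨u, hu⟩ := hE _ R.cauchy
  have hδ := R.δ_pos
  -- the limit stays in the ball `|u - u₀|_{3d} ≤ δ/128`
  have hball' : p (3 * d) (u - u₀) ≤ δ / 128 := by
    refine le_of_forall_pos_lt_add fun ε hε => ?_
    obtain ⟨K, hK⟩ := hu (3 * d) ε hε
    have h1 : p (3 * d) (u - u₀) ≤ p (3 * d) (u - seq S φ ψ u₀ θ₀ K) +
        p (3 * d) (seq S φ ψ u₀ θ₀ K - u₀) := by
      have := map_add_le_add (p (3 * d)) (u - seq S φ ψ u₀ θ₀ K)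
        (seq S φ ψ u₀ θ₀ K - u₀)
      rwa [sub_add_sub_cancel] at this
    have h2 := (R.good K).1
    have h3 := hK K le_rfl
    rw [map_sub_rev] at h3
    linarith
  have hball : p (3 * d) (u - u₀) < δ := lt_of_le_of_lt hball' (by linarith)
  refine ⟨u, hball, hq _ ?_⟩
  -- `‖φ(u)‖_{2d} = 0`
  refine le_antisymm (le_of_forall_pos_lt_add fun ε hε => ?_) (apply_nonneg _ _)
  have hC₁ := H.C₁_nonneg
  obtain ⟨K₁, hK₁⟩ := hu (3 * d) (ε / (2 * (C₁ + 1))) (by positivity)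
  obtain ⟨K₂, hK₂⟩ := R.eventually_small zero_le_one (half_pos hε)
  set n := max K₁ K₂ with hn
  have hgood := R.good n
  have hballn := hgood.ball R
  have h1 : q (2 * d) (φ u) ≤ q (2 * d) (φ u - φ (seq S φ ψ u₀ θ₀ n)) +
      q (2 * d) (φ (seq S φ ψ u₀ θ₀ n)) := by
    have := map_add_le_add (q (2 * d)) (φ u - φ (seq S φ ψ u₀ θ₀ n))
      (φ (seq S φ ψ u₀ θ₀ n))
    rwa [sub_add_cancel] at this
  have h2 := H.lipschitz _ u hballn hball
  have h3 := hK₁ n (le_max_left _ _)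
  rw [map_sub_rev] at h3
  have h4 : q (2 * d) (φ (seq S φ ψ u₀ θ₀ n)) < ε / 2 := by
    refine hgood.2.trans_lt ?_
    have h5 := hK₂ n (le_max_right _ _)
    rw [one_mul] at h5
    refine lt_of_le_of_lt ?_ h5
    rw [← Real.rpow_neg_one]
    exact Real.rpow_le_rpow_of_exponent_le (R.one_le_theta n) (by norm_num)
  have h6 : C₁ * (ε / (2 * (C₁ + 1))) ≤ ε / 2 := by
    rw [show C₁ * (ε / (2 * (C₁ + 1))) = C₁ / (C₁ + 1) * (ε / 2) by field_simp]
    exact mul_le_of_le_one_left (by positivity) (div_le_one_of_le₀ (by linarith) (by positivity))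
  have h7 : C₁ * p (3 * d) (u - seq S φ ψ u₀ θ₀ n) ≤
      C₁ * (ε / (2 * (C₁ + 1))) := mul_le_mul_of_nonneg_left h3.le hC₁
  linarith

/-! ## §6 From the printed `C²` hypotheses to the integrated bounds `lipschitz` / `taylor`

For a map between real normed spaces the second and third lines of (1) — bounds on `φ'` and `φ''` on
the convex ball — give the two integrated inequalities assumed in `Hypotheses` by the mean value
inequality (Mathlib's `Convex.norm_image_sub_le_of_norm_hasFDerivWithin_le` and its primed version);
this is the content of the two integrals written on p.222 and p.223 of the printed proof. -/

section FromC2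

variable {X : Type*} {Y : Type*} [NormedAddCommGroup X] [NormedSpace ℝ X]
  [NormedAddCommGroup Y] [NormedSpace ℝ Y]

/-- (1) second line ⇒ `lipschitz`: `‖φ'(u)‖ ≤ C₁` on a convex set gives
`‖φ(u') − φ(u)‖ ≤ C₁ ‖u' − u‖` there. [cite: SaintRaymond1989, (1) p.219 and p.223 last display] -/
theorem norm_sub_le_of_norm_fderiv_le {f : X → Y} {f' : X → X →L[ℝ] Y} {s : Set X} {C₁ : ℝ}
    (hs : Convex ℝ s) (hf : ∀ x ∈ s, HasFDerivWithinAt f (f' x) s x) (h1 : ∀ x ∈ s, ‖f' x‖ ≤ C₁)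
    {u u' : X} (hu : u ∈ s) (hu' : u' ∈ s) : ‖f u' - f u‖ ≤ C₁ * ‖u' - u‖ :=
  hs.norm_image_sub_le_of_norm_hasFDerivWithin_le hf h1 hu hu'

/-- (1) third line ⇒ the derivative is `C₂`-Lipschitz: `‖φ''(u)‖ ≤ C₂` on a convex set gives
`‖φ'(z) − φ'(x)‖ ≤ C₂ ‖z − x‖` there. [cite: SaintRaymond1989, (1) p.219] -/
theorem norm_fderiv_sub_le_of_norm_fderiv₂_le {f' : X → X →L[ℝ] Y} {f'' : X → X →L[ℝ] X →L[ℝ] Y}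
    {s : Set X} {C₂ : ℝ} (hs : Convex ℝ s) (hf' : ∀ x ∈ s, HasFDerivWithinAt f' (f'' x) s x)
    (h2 : ∀ x ∈ s, ‖f'' x‖ ≤ C₂) {x z : X} (hx : x ∈ s) (hz : z ∈ s) :
    ‖f' z - f' x‖ ≤ C₂ * ‖z - x‖ :=
  hs.norm_image_sub_le_of_norm_hasFDerivWithin_le hf' h2 hx hz

/-- A `C₂`-Lipschitz derivative on a convex set gives the second-order Taylor bound `taylor`:
`‖φ(u') − φ(u) − φ'(u)(u' − u)‖ ≤ C₂ ‖u' − u‖²` (the print has `C₂/2` from `∫₀¹ (1−t) dt`; the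
mean value inequality on `s ∩ B̄(u, ‖u'−u‖)` gives the constant `C₂`, which is all the proof uses).
[cite: SaintRaymond1989, (1) p.219 and the Taylor formula p.222] -/
theorem norm_taylor₂_le_of_lipschitz_fderiv {f : X → Y} {f' : X → X →L[ℝ] Y} {s : Set X} {C₂ : ℝ}
    (hs : Convex ℝ s) (hf : ∀ x ∈ s, HasFDerivWithinAt f (f' x) s x)
    (h2 : ∀ x ∈ s, ∀ z ∈ s, ‖f' z - f' x‖ ≤ C₂ * ‖z - x‖) (hC₂ : 0 ≤ C₂)
    {u u' : X} (hu : u ∈ s) (hu' : u' ∈ s) :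
    ‖f u' - f u - f' u (u' - u)‖ ≤ C₂ * ‖u' - u‖ ^ 2 := by
  set s' : Set X := s ∩ Metric.closedBall u ‖u' - u‖ with hs'def
  have hs' : Convex ℝ s' := hs.inter (convex_closedBall _ _)
  have hus' : u ∈ s' := ⟨hu, Metric.mem_closedBall_self (norm_nonneg _)⟩
  have hu's' : u' ∈ s' := ⟨hu', by rw [Metric.mem_closedBall, dist_eq_norm]⟩
  have hf' : ∀ x ∈ s', HasFDerivWithinAt f (f' x) s' x :=
    fun x hx => (hf x hx.1).mono Set.inter_subset_left
  have hb : ∀ z ∈ s', ‖f' z - f' u‖ ≤ C₂ * ‖u' - u‖ := by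
    intro z hz
    have hzu : ‖z - u‖ ≤ ‖u' - u‖ := by
      have := hz.2; rwa [Metric.mem_closedBall, dist_eq_norm] at this
    exact (h2 u hu z hz.1).trans (mul_le_mul_of_nonneg_left hzu hC₂)
  calc ‖f u' - f u - f' u (u' - u)‖ ≤ C₂ * ‖u' - u‖ * ‖u' - u‖ :=
        hs'.norm_image_sub_le_of_norm_hasFDerivWithin_le' hf' hb hus' hu's'
    _ = C₂ * ‖u' - u‖ ^ 2 := by ring

/-- The two together: `‖φ''‖ ≤ C₂` on a convex set ⇒ the Taylor bound with constant `C₂`.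
[cite: SaintRaymond1989, (1) p.219 and p.222] -/
theorem norm_taylor₂_le_of_norm_fderiv₂_le {f : X → Y} {f' : X → X →L[ℝ] Y}
    {f'' : X → X →L[ℝ] X →L[ℝ] Y} {s : Set X} {C₂ : ℝ} (hs : Convex ℝ s)
    (hf : ∀ x ∈ s, HasFDerivWithinAt f (f' x) s x) (hf' : ∀ x ∈ s, HasFDerivWithinAt f' (f'' x) s x)
    (h2 : ∀ x ∈ s, ‖f'' x‖ ≤ C₂) (hC₂ : 0 ≤ C₂) {u u' : X} (hu : u ∈ s) (hu' : u' ∈ s) :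
    ‖f u' - f u - f' u (u' - u)‖ ≤ C₂ * ‖u' - u‖ ^ 2 :=
  norm_taylor₂_le_of_lipschitz_fderiv hs hf
    (fun _ hx _ hz => norm_fderiv_sub_le_of_norm_fderiv₂_le hs hf' h2 hx hz) hC₂ hu hu'

end FromC2

end SaintRaymond

end Literature.Analysis.Calculus
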